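import Literature.Probability.Percolation.ArmSeparationConvFour
import Literature.Probability.Percolation.ArmSeparationInExtFour
import HarnessLib

/-!
# The half-step: re-siding the closed arms and re-fencing all four arms, at constant cost, at `p`

Topic `Literature/Probability/Percolation`; family `crit-perc` / near-critical percolation on `𝕋`.
A brick of the near-critical arm-separation theorem for four arms of alternating colours
(P. Nolin, *Near-critical percolation in two dimensions*, EJP 13 (2008), Thm. 11 for `j = 4`,
`σ = BWBW` [arXiv 0711.4948: Thm. 10]; §4.2 "relocation of the landing sequences", §4.3
Prop. 12 (i), Lemma 13; §4.4 pp. 12–13): from the four arms of `sepFourArmQ m N` (open arms fenced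
on the sides `0, 3` in the rotation frames, closed arms fenced on the sides `2, 5` in the reflection
frames of `ArmSeparationInnerFrames`) to four arms fenced in the ROTATION frames on the sides
`0, 3` (open) and `1, 4` (closed) at the scales `(m', N')`, `2m' + 1 ≤ m ≤ 3m'`, `4N ≤ N' ≤ 32N` —
the shape consumed by `sepFourArm_of_arms` (`ArmSeparationConvFour`). The open arms are extended
along the bent corridors of `ArmSeparationInExtFour` (inside) and `ArmSeparationOutExtFour`
(outside, `sepOpenArm_inter_sepOutCorrQ_subset`); each closed arm is re-fenced at both ends along
corridors turning by `-60°` from the sector of the side `2` into the sector of the side `1`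
(`inBent`, `outBent`; `closedArm_halfStep`); the four corridors live in pairwise disjoint regions and
Nolin's Lemma 13 gives the inequality at `p` (`real_halfStep_mul_le_at`). Everything here is proved;
no named facts are introduced.

## References

* P. Nolin, Near-critical percolation in two dimensions, *Electron. J. Probab.* 13 (2008), §4.2–4.4
  (arXiv 0711.4948: Def. 6–8, Prop. 11, Lemma 12, proof of Thm. 10) [Nolin2008].
* H. Kesten, Scaling relations for 2D-percolation, *Comm. Math. Phys.* 109 (1987), Lemma 2 [Kesten1987].
-/

noncomputable section

open MeasureTheory Set

namespace Literature.Probability.Percolation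

open LatticeModels

/-! ### Open arms: outward extension of a fenced arm along the bent corridor -/
set_option maxHeartbeats 400000 in
/-- **Outward extension of a fenced arm along the bent corridor** (`sepOutCorrQ` of
`ArmSeparationOutExtFour`, for the fenced arm `sepOpenArm` instead of `extOpenArm`: the inner free
space is kept): `sepOpenArm m R ∩ sepOutCorrQ R R' ⊆ sepOpenArm m R'` for `2200 ≤ R`, `2m ≤ R`,
`2R ≤ R' ≤ 32R`. [cite: Nolin2008, §4.3 Prop. 12 (i) (proof) (arXiv 0711.4948: Prop. 11); §4.4 p. 12] -/
theorem sepOpenArm_inter_sepOutCorrQ_subset {m R R' : ℕ} (hR : 2200 ≤ R) (hmR : 2 * m ≤ R) (hRR' : 2 * R ≤ R') (hR'R : R' ≤ 32 * R) :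
    sepOpenArm m R ∩ sepOutCorrQ R R' ⊆ sepOpenArm m R' := by
  rintro ω ⟨⟨z, z', u, u', hz, hz', hIn, ⟨b, t, hb, ht, Pa, Pb⟩, P⟩, ⟨⟨⟨⟨⟨hV0, hH2⟩, hD⟩, hB⟩, hVh⟩, hG⟩⟩
  have hzL := hz
  rw [mem_sepLanding] at hzL
  obtain ⟨hz0, hz1, hz2⟩ := hzL
  have hz'L := hz'
  rw [mem_sepLanding] at hz'L
  set z'' : Site 2 := ![(R' : ℤ), -((R' / 2 : ℕ) : ℤ)] with hz''
  have hz''1 : z'' 1 = -((R' / 2 : ℕ) : ℤ) := site_mk_apply_one _ _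
  obtain ⟨b₀, t₀, hb₀, ht₀, PV⟩ := hV0
  obtain ⟨a₂, e₂, ha₂, he₂, PH2⟩ := hH2
  obtain ⟨bd, td, hbd, htd, PD⟩ := hD
  obtain ⟨ab, eb, hab, heb, PB⟩ := hB
  obtain ⟨bv, tv, hbv, htv, PVh⟩ := hVh
  obtain ⟨i, hi, hgi1, hgi2⟩ := exists_sepInComb_rows hR hz
  have hGi : ω ∈ sepOutComb R i := (Set.mem_iInter₂.1 hG) i (Finset.mem_range.2 hi)
  obtain ⟨g₀, g₁, hg₀, hg₁, PG⟩ := hGi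
  have hH := sepGlueHeight_cast R
  simp only [Nat.cast_mul, Nat.cast_ofNat] at ht₀ he₂
  have hih : (0 : ℤ) ≤ (i : ℤ) * ((R / 64 / 2 : ℕ) : ℤ) := by positivity
  have hih' : (i : ℤ) * ((R / 64 / 2 : ℕ) : ℤ) ≤ 89 * ((R / 64 / 2 : ℕ) : ℤ) :=
    mul_le_mul_of_nonneg_right (by exact_mod_cast Nat.le_of_lt_succ hi) (by positivity)
  have hRR : 2 * (R : ℤ) ≤ R' := by exact_mod_cast hRR'
  have hR'R' : (R' : ℤ) ≤ 32 * R := by exact_mod_cast hR'R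
  have e16 : ((R' / 16 - 1 : ℕ) : ℤ) = (R' / 16 : ℕ) - 1 := by omega
  have eD : ((R' / 2 - R / 2 + R' / 64 : ℕ) : ℤ) = (R' / 2 : ℕ) - (R / 2 : ℕ) + (R' / 64 : ℕ) := by omega
  have eB : ((R' - (R + R / 8 + 1) : ℕ) : ℤ) = (R' : ℤ) - R - (R / 8 : ℕ) - 1 := by omega
  rw [eD] at htd
  rw [eB] at heb
  -- junction with the target free space
  obtain ⟨SH, hSH, PH', TH⟩ := PH2.exists_support
  obtain ⟨SV, hSV, PV', TV⟩ := PV.exists_support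
  obtain ⟨p₁, hp₁H, hp₁V⟩ := exists_mem_of_cross (L := (R' : ℤ) + 1) (R := (R' : ℤ) + (R' / 16 : ℕ))
    (B := -((R' / 2 : ℕ) : ℤ) - (R' / 64 : ℕ)) (T := -((R' / 2 : ℕ) : ℤ) + (R' / 64 : ℕ)) (by omega) (by omega)
    PH' (by omega) (by omega)
    (fun v hv _ _ => by have h := (hSH hv).1; rw [mem_triStrip] at h; omega)
    PV' hb₀.le (by omega)
    (fun v hv _ _ => by
      have h := (hSV hv).1; rw [mem_triStrip, e16] at h
      omega)
  have hSVF : SV ⊆ sepOuterFence R' z'' ∩ ω := fun v hv => ⟨sepOutCorrFence_subset_sepOuterFence (by omega) (hSV hv).1, (hSV hv).2⟩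
  have hFence : OpenVCrossThrough (sepOuterFence R' z'') (z'' 1 - (R' / 64 : ℕ)) (z'' 1 + (R' / 64 : ℕ)) ω p₁ :=
    ⟨b₀, t₀, by rw [hz''1, hb₀], by rw [hz''1, ht₀]; ring, (TV p₁ hp₁V).mono hSVF,
      ((TV p₁ hp₁V).symm.trans (TV t₀ PV'.right_mem)).mono hSVF⟩
  -- the relays
  have Q1 : PathIn triGraph (triStrip ((R' : ℤ) - (R' / 16 : ℕ)) (-((R' / 2 : ℕ) : ℤ)) (2 * (R' / 16)) (R' / 64) ∩ ω) a₂ p₁ :=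
    (TH p₁ hp₁H).mono hSH
  have QH := PathIn.relay (L := (R' : ℤ) - (R' / 16 : ℕ)) (R := (R' : ℤ) - 1) (B := -((R' / 2 : ℕ) : ℤ))
    (T := -((R' / 2 : ℕ) : ℤ) + (R' / 64 : ℕ)) (by omega) (by omega) PH2 (by omega) (by omega)
    (fun v hv _ _ => by rw [mem_triStrip] at hv; omega) PD hbd.le (by omega)
    (fun v hv _ _ => by rw [mem_triStrip, e16] at hv; omega)
  have Q1b := PathIn.relay (L := (R' : ℤ) - (R' / 16 : ℕ)) (R := (R' : ℤ) - 1) (B := -((R / 2 : ℕ) : ℤ))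
    (T := -((R / 2 : ℕ) : ℤ) + (R' / 64 : ℕ)) (by omega) (by omega) PB (by omega) (by omega)
    (fun v hv _ _ => by rw [mem_triStrip] at hv; omega) PD (by omega) (by omega)
    (fun v hv _ _ => by rw [mem_triStrip, e16] at hv; omega)
  have Q2 := PathIn.relay (L := (R : ℤ) + (R / 8 : ℕ) + 1) (R := (R : ℤ) + 1 + 2 * (R / 8 : ℕ))
    (B := -(sepGlueHeight R : ℤ)) (T := 0) (by omega) (by omega) PB (by omega) (by omega)
    (fun v hv _ _ => by rw [mem_triStrip] at hv; omega) PVh hbv.le (by omega)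
    (fun v hv _ _ => by rw [mem_triStrip] at hv; omega)
  have Q3 := PathIn.relay (L := (R : ℤ) + (R / 8 : ℕ) + 1) (R := (R : ℤ) + 1 + 2 * (R / 8 : ℕ))
    (B := -(sepGlueHeight R : ℤ)) (T := 0) (by omega) (by omega) PG (by omega) (by omega)
    (fun v hv _ _ => by rw [sepOutComb_strip_iff] at hv; omega) PVh hbv.le (by omega)
    (fun v hv _ _ => by rw [mem_triStrip] at hv; omega)
  have Q4 := PathIn.relay (L := (R : ℤ) + 1) (R := (R : ℤ) + (R / 8 : ℕ)) (B := z 1 - (R / 64 : ℕ)) (T := z 1 + (R / 64 : ℕ))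
    (by omega) (by omega) PG (by omega) (by omega)
    (fun v hv _ _ => by rw [sepOutComb_strip_iff] at hv; omega) (Pa.trans Pb) hb.le ht.ge
    (fun v hv _ _ => by rw [mem_sepOuterFence] at hv; omega)
  -- the regions
  have hmR' : m ≤ R := by omega
  have hstrip : triStrip ((R' : ℤ) - (R' / 16 : ℕ)) (-((R' / 2 : ℕ) : ℤ)) (2 * (R' / 16)) (R' / 64) ⊆
      triStrip ((R : ℤ) + (R / 8 : ℕ) + 1) (-((R' / 2 : ℕ) : ℤ)) (R' + R' / 16 - (R + R / 8 + 1)) (R' / 64) := by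
    intro v hv
    rw [mem_triStrip] at hv ⊢
    rw [cast_sepOutCorr_width (by omega) hRR']
    push_cast at hv
    omega
  have R1 : triStrip ((R' : ℤ) - (R' / 16 : ℕ)) (-((R' / 2 : ℕ) : ℤ)) (2 * (R' / 16)) (R' / 64) ⊆
      triAnnulusSet m R' ∪ triOpenBall z'' (R' / 8) :=
    hstrip.trans (sepOutCorrHBox_subset (n := m) (R := R) (R' := R') (by omega) hmR' hRR')
  have R4 := sepOuterFence_subset_triAnnulusSet (n := m) (R' := R') hmR' hRR' hz
  have R5 : sepJoinRegion m R z z' ⊆ sepJoinRegion m R' z'' z' := by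
    have hmR2 : 2 * (m : ℤ) ≤ R := by exact_mod_cast hmR
    rintro v ((hv | hv) | hv)
    · rw [mem_triAnnulusSet] at hv
      exact Or.inl (Or.inl ⟨hv.1, by omega⟩)
    · rw [mem_triOpenBall, triNorm_lt_iff_lin] at hv
      simp only [Pi.sub_apply] at hv
      refine Or.inl (Or.inl ⟨le_triNorm_iff_lin.2 (Or.inl (by omega)), triNorm_le_iff_lin.2 ?_⟩)
      omega
    · exact Or.inr hv
  have RD : triStrip ((R' : ℤ) - (R' / 16 : ℕ)) (-((R' / 2 : ℕ) : ℤ)) (R' / 16 - 1) (R' / 2 - R / 2 + R' / 64) ⊆ triAnnulusSet m R' :=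
    fun v hv => by
      rw [mem_triStrip, e16, eD] at hv
      exact mem_triAnnulusSet_of_box (by omega) (by omega) (by omega) (by omega) (by omega)
  have RB : triStrip ((R : ℤ) + (R / 8 : ℕ) + 1) (-((R / 2 : ℕ) : ℤ)) (R' - (R + R / 8 + 1)) (R' / 64) ⊆ triAnnulusSet m R' :=
    fun v hv => by
      rw [mem_triStrip, eB] at hv
      exact mem_triAnnulusSet_of_box (by omega) (by omega) (by omega) (by omega) (by omega)
  have RVh : triStrip ((R : ℤ) + (R / 8 : ℕ) + 1) (-(sepGlueHeight R : ℤ)) (R / 8) (sepGlueHeight R) ⊆ triAnnulusSet m R' :=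
    fun v hv => by
      rw [mem_triStrip] at hv
      exact mem_triAnnulusSet_of_cols_rows_out (by omega) hmR' hRR' (by omega) (by omega) (by omega) (by omega)
  have RG : triStrip ((R : ℤ) + 1) (-(sepGlueHeight R : ℤ) + i * ((R / 64 / 2 : ℕ) : ℤ)) (2 * (R / 8)) (R / 64 / 2) ⊆
      triAnnulusSet m R' := fun v hv => by
    rw [sepOutComb_strip_iff] at hv
    exact mem_triAnnulusSet_of_cols_rows_out (by omega) hmR' hRR' hv.1 hv.2.1 (by omega) (by omega)
  have hann : triAnnulusSet m R' ⊆ sepJoinRegion m R' z'' z' := fun v hv => Or.inl (Or.inl hv)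
  have hR1' : triAnnulusSet m R' ∪ triOpenBall z'' (R' / 8) ⊆ sepJoinRegion m R' z'' z' := fun v hv => Or.inl hv
  set Reg := sepJoinRegion m R' z'' z' ∩ ω with hReg
  have P1 : PathIn triGraph Reg a₂ p₁ := Q1.mono fun v hv => ⟨hR1' (R1 hv.1), hv.2⟩
  have PHd : PathIn triGraph Reg bd a₂ := by
    refine QH.symm.mono ?_
    rintro v ⟨hv | hv, hvω⟩
    exacts [⟨hR1' (R1 hv), hvω⟩, ⟨hann (RD hv), hvω⟩]
  have P1b : PathIn triGraph Reg ab bd := by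
    refine Q1b.mono ?_
    rintro v ⟨hv | hv, hvω⟩
    exacts [⟨hann (RB hv), hvω⟩, ⟨hann (RD hv), hvω⟩]
  have P2 : PathIn triGraph Reg bv ab := by
    refine Q2.symm.mono ?_
    rintro v ⟨hv | hv, hvω⟩
    exacts [⟨hann (RB hv), hvω⟩, ⟨hann (RVh hv), hvω⟩]
  have P3 : PathIn triGraph Reg g₀ bv := by
    refine Q3.mono ?_
    rintro v ⟨hv | hv, hvω⟩
    exacts [⟨hann (RG hv), hvω⟩, ⟨hann (RVh hv), hvω⟩]
  have P4 : PathIn triGraph Reg b g₀ := by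
    refine Q4.symm.mono ?_
    rintro v ⟨hv | hv, hvω⟩
    exacts [⟨hann (RG hv), hvω⟩, ⟨hann (R4 hv), hvω⟩]
  have P6 : PathIn triGraph Reg u' b := Pa.symm.mono fun v hv => ⟨hann (R4 hv.1), hv.2⟩
  have P7 : PathIn triGraph Reg u u' := P.mono fun v hv => ⟨R5 hv.1, hv.2⟩
  exact ⟨z'', z', u, p₁, mk_mem_sepLanding R', hz', hIn, hFence,
    ((((((P7.trans P6).trans P4).trans P3).trans P2).trans P1b).trans PHd).trans P1⟩

/-- **The open arms of the half-step**: inward along `sepInCorrQ m m'` and outward along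
`sepOutCorrQ N N'`: `sepOpenArm m N ∩ sepInCorrQ m m' ∩ sepOutCorrQ N N' ⊆ sepOpenArm m' N'`. [cite: Nolin2008, §4.3 Prop. 12 (i) (arXiv 0711.4948: Prop. 11); §4.4 pp. 12–13] -/
theorem openArm_halfStep {m m' N N' : ℕ} (hm' : 1100 ≤ m') (hmm' : 2 * m' + 1 ≤ m) (hm3 : m ≤ 3 * m')
    (hN : 2200 ≤ N) (hmN : 2 * m ≤ N) (hNN' : 2 * N ≤ N') (hN'N : N' ≤ 32 * N) :
    sepOpenArm m N ∩ sepInCorrQ m m' ∩ sepOutCorrQ N N' ⊆ sepOpenArm m' N' := by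
  rintro ω ⟨⟨hA, hI⟩, hO⟩
  have h1 : ω ∈ sepOpenArm m' N := by
    rw [← sepArmGen_zero] at hA ⊢
    exact sepArmGen_inter_sepInCorrQ_subset hm' hmm' hm3 hmN ⟨hA, hI⟩
  exact sepOpenArm_inter_sepOutCorrQ_subset hN (by omega) hNN' hN'N ⟨h1, hO⟩

/-! ### The bent corridors of the closed arms -/

/-- The `i`-th comb strip of the inner bend (columns `[g_i, g_i + h]`, rows
`[m - m/8 - m/16 - 2, m - 1]`), crossed vertically. [cite: Nolin2008, §4.3 Prop. 12 (proof) (arXiv 0711.4948: Prop. 11)] -/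
def inCombB (m i : ℕ) : Set (SiteConfig (Site 2)) :=
  triVCross (-(sepGlueHeight m : ℤ) + i * ((m / 64 / 2 : ℕ) : ℤ)) ((m : ℤ) - (m / 8 : ℕ) - (m / 16 : ℕ) - 2) (m / 64 / 2) (m / 8 + m / 16 + 1)

/-- **The inner bend** (from the top side of `Λ_m` to the side `1` of `Λ_{m'}`, in the original
coordinates; `p₂ = m'/2`, `p₈ = m'/8`, `p₆₄ = m'/64`): a thinned new free space read in the frame `1`,
the junction box (columns `[p₂, p₂ + p₆₄]`, rows `[p₂ - p₈ + 2, p₂ + p₈]`), the connector (rows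
`[p₂, p₂ + p₈]`, columns `[p₂, p₂ + 2p₆₄]`), the approach (columns `[p₂, p₂ + 2p₆₄]`, rows
`[p₂, m - m' + p₆₄]`), the traverse (rows `[m - m', m - m' + p₆₄]`, columns `[1, p₂ + 2p₆₄]`), the
descent (columns `[1, 1 + m/16]`, rows `[m - m', m - m/8 - 2]`), the highway (rows
`[m - m/8 - m/16 - 2, m - m/8 - 2]`, columns `[-G, 1 + m/16]`) and the comb strips over the old free
space. [cite: Nolin2008, §4.2 (relocation of landing sequences), §4.3 Prop. 12 (proof) (arXiv 0711.4948: Def. 8, Prop. 11)] -/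
def inBent (m m' : ℕ) : Set (SiteConfig (Site 2)) :=
  {χ | rotConfig 1 χ ∈ triVCross ((m' : ℤ) - (m' / 8 : ℕ) + 2 + (m' / 64 : ℕ)) (-((m' / 2 : ℕ) : ℤ) - (m' / 64 : ℕ)) (m' / 8 - 3 - m' / 64) (2 * (m' / 64))} ∩
    triVCross ((m' / 2 : ℕ) : ℤ) (((m' / 2 : ℕ) : ℤ) - (m' / 8 : ℕ) + 2) (m' / 64) (2 * (m' / 8) - 2) ∩
    triHCross ((m' / 2 : ℕ) : ℤ) ((m' / 2 : ℕ) : ℤ) (2 * (m' / 64)) (m' / 8) ∩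
    triVCross ((m' / 2 : ℕ) : ℤ) ((m' / 2 : ℕ) : ℤ) (2 * (m' / 64)) (m - m' + m' / 64 - m' / 2) ∩
    triHCross 1 ((m : ℤ) - m') (m' / 2 + 2 * (m' / 64) - 1) (m' / 64) ∩
    triVCross 1 ((m : ℤ) - m') (m / 16) (m' - m / 8 - 2) ∩
    triHCross (-(sepGlueHeight m : ℤ)) ((m : ℤ) - (m / 8 : ℕ) - (m / 16 : ℕ) - 2) (sepGlueHeight m + 1 + m / 16) (m / 16) ∩
    ⋂ i ∈ Finset.range 90, inCombB m i

/-- The `j`-th comb strip of the outer bend (columns `[g_j, g_j + h]`, rows `[N + 1, N + 1 + 2(N/8)]`),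
crossed vertically. [cite: Nolin2008, §4.3 Prop. 12 (proof) (arXiv 0711.4948: Prop. 11)] -/
def outCombB (N j : ℕ) : Set (SiteConfig (Site 2)) :=
  triVCross (-(sepGlueHeight N : ℤ) + j * ((N / 64 / 2 : ℕ) : ℤ)) ((N : ℤ) + 1) (N / 64 / 2) (2 * (N / 8))

/-- **The outer bend** (from the top side of `∂Λ_N` to the side `1` of `∂Λ_{N'}`, in the original
coordinates): the comb strips over the old free space, the highway (rows `[N + N/8 + 1, N + 1 + 2(N/8)]`,
columns `[-G, 1 + N/4]`), the ascent (columns `[1, 1 + N/4]`, up to the row `N'/2 - N'/16 + N'/64`), the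
traverse (rows `[N'/2 - N'/16, · + N'/64]`, columns `[1, N'/2]`), the approach (columns
`[N'/2 - N'/64, N'/2]`, rows up to `N'/2 + N'/16 + N'/64 + 1`) and the thinned new free space read in
the frame `1` (`sepOutCorrQ`'s first box). [cite: Nolin2008, §4.2 (relocation of landing sequences), §4.3 Prop. 12 (proof) (arXiv 0711.4948: Def. 8, Prop. 11)] -/
def outBent (N N' : ℕ) : Set (SiteConfig (Site 2)) :=
  {χ | rotConfig 1 χ ∈ triVCross ((N' : ℤ) + 1) (-((N' / 2 : ℕ) : ℤ) - (N' / 64 : ℕ)) (N' / 16 - 1) (2 * (N' / 64))} ∩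
    triVCross (((N' / 2 : ℕ) : ℤ) - (N' / 64 : ℕ)) (((N' / 2 : ℕ) : ℤ) - (N' / 16 : ℕ)) (N' / 64) (2 * (N' / 16) + N' / 64 + 1) ∩
    triHCross 1 (((N' / 2 : ℕ) : ℤ) - (N' / 16 : ℕ)) (N' / 2 - 1) (N' / 64) ∩
    triVCross 1 ((N : ℤ) + (N / 8 : ℕ) + 1) (2 * (N / 8)) (N' / 2 - N' / 16 + N' / 64 - N - N / 8 - 1) ∩
    triHCross (-(sepGlueHeight N : ℤ)) ((N : ℤ) + (N / 8 : ℕ) + 1) (sepGlueHeight N + 1 + 2 * (N / 8)) (N / 8) ∩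
    ⋂ j ∈ Finset.range 90, outCombB N j

/-- Reading in the frame `1` preserves monotonicity of a vertical crossing event. [folklore] -/
theorem isUpperSet_rot1_triVCross (a b : ℤ) (w h : ℕ) :
    IsUpperSet {χ : SiteConfig (Site 2) | rotConfig 1 χ ∈ triVCross a b w h} := fun _ _ hle hω =>
  isUpperSet_triVCross a b w h (fun v hv => by rw [mem_rotConfig] at hv ⊢; exact hle hv) hω

/-- `inBent` is increasing. [folklore] -/
theorem isUpperSet_inBent (m m' : ℕ) : IsUpperSet (inBent m m') := by
  refine (((((((isUpperSet_rot1_triVCross _ _ _ _).inter (isUpperSet_triVCross _ _ _ _)).inter (isUpperSet_triHCross _ _ _ _)).inter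
    (isUpperSet_triVCross _ _ _ _)).inter (isUpperSet_triHCross _ _ _ _)).inter (isUpperSet_triVCross _ _ _ _)).inter
    (isUpperSet_triHCross _ _ _ _)).inter ?_
  exact isUpperSet_iInter₂ fun i _ => isUpperSet_triVCross _ _ _ _

/-- `outBent` is increasing. [folklore] -/
theorem isUpperSet_outBent (N N' : ℕ) : IsUpperSet (outBent N N') := by
  refine (((((isUpperSet_rot1_triVCross _ _ _ _).inter (isUpperSet_triVCross _ _ _ _)).inter (isUpperSet_triHCross _ _ _ _)).inter
    (isUpperSet_triVCross _ _ _ _)).inter (isUpperSet_triHCross _ _ _ _)).inter ?_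
  exact isUpperSet_iInter₂ fun i _ => isUpperSet_triVCross _ _ _ _

/-! ### The deterministic re-fencing of a closed arm -/

/-- Transport of a path of `frameConfig 2 κ` (the reflection frame of the top side) to `κ`. [folklore] -/
theorem pathIn_of_frameConfig_two {A : Set (Site 2)} {κ : SiteConfig (Site 2)} {x y : Site 2}
    (h : PathIn triGraph (A ∩ frameConfig 2 κ) x y) :
    PathIn triGraph ((frameIso 2 '' A) ∩ κ) (frameIso 2 x) (frameIso 2 y) := by
  refine (pathIn_map_iso (frameIso 2) h).mono ?_
  rintro _ ⟨v, ⟨hvA, hvκ⟩, rfl⟩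
  exact ⟨⟨v, hvA, rfl⟩, mem_frameConfig.1 hvκ⟩

/-- Transport of a path of `rotConfig 1 κ` to `κ`. [folklore] -/
theorem pathIn_of_rotConfig_one {A : Set (Site 2)} {κ : SiteConfig (Site 2)} {x y : Site 2}
    (h : PathIn triGraph (A ∩ rotConfig 1 κ) x y) :
    PathIn triGraph ((triRotIsoPow 1 '' A) ∩ κ) (triRotIsoPow 1 x) (triRotIsoPow 1 y) := by
  refine (pathIn_map_iso (triRotIsoPow 1) h).mono ?_
  rintro _ ⟨v, ⟨hvA, hvκ⟩, rfl⟩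
  exact ⟨⟨v, hvA, rfl⟩, mem_rotConfig.1 hvκ⟩

/-- `ρ (ρ⁵ v) = v`. [folklore] -/
theorem rot1_rot5 (v : Site 2) : triRotIsoPow 1 (triRotIsoPow 5 v) = v := by
  rw [← triRotIsoPow_add_apply 5 1 v, triRotIsoPow_six_apply]

/-- `ρ⁵ (ρ v) = v`. [folklore] -/
theorem rot5_rot1 (v : Site 2) : triRotIsoPow 5 (triRotIsoPow 1 v) = v := by
  rw [← triRotIsoPow_add_apply 1 5 v, triRotIsoPow_six_apply]

/-- Transport of a path of `κ` to `rotConfig 1 κ` by `ρ⁵ = ρ⁻¹`. [folklore] -/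
theorem pathIn_rotConfig_one_of {A : Set (Site 2)} {κ : SiteConfig (Site 2)} {x y : Site 2}
    (h : PathIn triGraph (A ∩ κ) x y) :
    PathIn triGraph ((triRotIsoPow 5 '' A) ∩ rotConfig 1 κ) (triRotIsoPow 5 x) (triRotIsoPow 5 y) := by
  refine (pathIn_map_iso (triRotIsoPow 5) h).mono ?_
  rintro _ ⟨v, ⟨hvA, hvκ⟩, rfl⟩
  refine ⟨⟨v, hvA, rfl⟩, ?_⟩
  rw [mem_rotConfig]
  show triRotIsoPow 1 (triRotIsoPow 5 v) ∈ κ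
  rw [rot1_rot5]; exact hvκ

/-- Coordinates of `ρ⁵ v = ρ⁻¹ v`. [folklore] -/
theorem rot5_apply (v : Site 2) : (triRotIsoPow 5 v) 0 = v 0 + v 1 ∧ (triRotIsoPow 5 v) 1 = -v 0 := by
  obtain ⟨-, -, -, -, -, -, -, -, -, -, h0, h1⟩ := rot_apply_formula v
  exact ⟨h0, h1⟩

/-- Coordinates of `ρ v`. [folklore] -/
theorem rot1_apply (v : Site 2) : (triRotIsoPow 1 v) 0 = -v 1 ∧ (triRotIsoPow 1 v) 1 = v 0 + v 1 := by
  obtain ⟨-, -, h0, h1, -⟩ := rot_apply_formula v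
  exact ⟨h0, h1⟩

/-- Coordinates of `frameIso 2 v` (the reflection `(x, y) ↦ (y, x)`). [folklore] -/
theorem frameIso2_apply (v : Site 2) : (frameIso 2 v) 0 = v 1 ∧ (frameIso 2 v) 1 = v 0 := by
  obtain ⟨-, -, -, -, h0, h1, -⟩ := frameIso_apply_formula v
  exact ⟨h0, h1⟩

/-- Floor bounds of an integer division, cast to `ℤ` (used to hide the divisions from `omega`). [folklore] -/
theorem flz (m c : ℕ) (hc : 0 < c) : (c : ℤ) * (m / c : ℕ) ≤ m ∧ (m : ℤ) < c * (m / c : ℕ) + c := by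
  have h1 : m / c * c ≤ m := Nat.div_mul_le_self m c
  have h2 : m < m / c * c + c := Nat.lt_div_mul_add hc
  have h1' : ((m / c : ℕ) : ℤ) * (c : ℤ) ≤ m := by
    have := (Nat.cast_le (α := ℤ)).2 h1; simpa only [Nat.cast_mul] using this
  have h2' : (m : ℤ) < ((m / c : ℕ) : ℤ) * (c : ℤ) + c := by
    have := (Nat.cast_lt (α := ℤ)).2 h2; simpa only [Nat.cast_mul, Nat.cast_add] using this
  constructor <;> linarith [mul_comm ((m / c : ℕ) : ℤ) (c : ℤ)]

/-- The union of the norm shell `{lo ≤ ‖v‖ ≤ hi}` and the open ball `B(c, r)` (the region of a bend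
glued to an old free space). [folklore] -/
def shellBall (lo hi : ℤ) (c : Site 2) (r : ℕ) : Set (Site 2) :=
  {v : Site 2 | lo ≤ triNorm v ∧ triNorm v ≤ hi} ∪ triOpenBall c r

/-- Membership in `shellBall`. [folklore] -/
theorem mem_shellBall {lo hi : ℤ} {c : Site 2} {r : ℕ} {v : Site 2} :
    v ∈ shellBall lo hi c r ↔ (lo ≤ triNorm v ∧ triNorm v ≤ hi) ∨ v ∈ triOpenBall c r := Iff.rfl

/-- Membership in `shellBall` from coordinates in the closed first quadrant `{0 ≤ x₀, 0 ≤ x₁}`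
(norm `x₀ + x₁`). [folklore] -/
theorem mem_shell_of_quadrant {lo hi : ℤ} {c : Site 2} {r : ℕ} {v : Site 2} (h1 : lo ≤ v 0 + v 1) (h2 : v 0 + v 1 ≤ hi)
    (h3 : 0 ≤ v 0) (h4 : 0 ≤ v 1) : v ∈ shellBall lo hi c r :=
  Or.inl ⟨le_triNorm_iff_lin.2 (Or.inr (Or.inr (Or.inr (Or.inr (Or.inl h1))))), triNorm_le_iff_lin.2 (by omega)⟩

/-- Membership in `shellBall` from coordinates in the sector of the top side `{x₀ ≤ 0 ≤ x₀ + x₁}`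
(norm `x₁`). [folklore] -/
theorem mem_shell_of_topSector {lo hi : ℤ} {c : Site 2} {r : ℕ} {v : Site 2} (h1 : lo ≤ v 1) (h2 : v 1 ≤ hi)
    (h3 : v 0 ≤ 0) (h4 : 0 ≤ v 0 + v 1) : v ∈ shellBall lo hi c r :=
  Or.inl ⟨le_triNorm_iff_lin.2 (Or.inr (Or.inr (Or.inl h1))), triNorm_le_iff_lin.2 (by omega)⟩

/-- Membership in `shellBall` through the ball, from the coordinates of the centre. [folklore] -/
theorem mem_shell_of_near {lo hi : ℤ} {c : Site 2} {r : ℕ} {v : Site 2}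
    (h1 : v 0 - c 0 < r) (h2 : c 0 - v 0 < r) (h3 : v 1 - c 1 < r) (h4 : c 1 - v 1 < r)
    (h5 : v 0 + v 1 - (c 0 + c 1) < r) (h6 : c 0 + c 1 - (v 0 + v 1) < r) : v ∈ shellBall lo hi c r := by
  refine Or.inr ?_
  rw [mem_triOpenBall, triNorm_lt_iff_lin]
  simp only [Pi.sub_apply]
  omega

/-- Arithmetic helper. [folklore] -/
private theorem castI1 {m m' : ℕ} (hm' : 64 ≤ m') (hm3 : m ≤ 3 * m') :
    ((m' - m / 8 - 2 : ℕ) : ℤ) = (m' : ℤ) - (m / 8 : ℕ) - 2 := by omega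
/-- Arithmetic helper. [folklore] -/
private theorem castI2 {m' : ℕ} (hm' : 64 ≤ m') : ((m' / 2 + 2 * (m' / 64) - 1 : ℕ) : ℤ) = (m' / 2 : ℕ) + 2 * (m' / 64 : ℕ) - 1 := by omega
/-- Arithmetic helper. [folklore] -/
private theorem castI3 {m m' : ℕ} (hmm' : 2 * m' + 1 ≤ m) :
    ((m - m' + m' / 64 - m' / 2 : ℕ) : ℤ) = (m : ℤ) - m' + (m' / 64 : ℕ) - (m' / 2 : ℕ) := by omega
/-- Arithmetic helper. [folklore] -/
private theorem castI5 {m' : ℕ} (hm' : 64 ≤ m') : ((2 * (m' / 8) - 2 : ℕ) : ℤ) = 2 * (m' / 8 : ℕ) - 2 := by omega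
/-- Arithmetic helper. [folklore] -/
private theorem castI4 {m' : ℕ} (hm' : 1100 ≤ m') : ((m' / 8 - 3 - m' / 64 : ℕ) : ℤ) = (m' / 8 : ℕ) - 3 - (m' / 64 : ℕ) := by omega
/-- Arithmetic helper. [folklore] -/
private theorem castO5 {N' : ℕ} (hN' : 64 ≤ N') : ((N' / 2 - 1 : ℕ) : ℤ) = (N' / 2 : ℕ) - 1 := by omega
/-- Arithmetic helper. [folklore] -/
private theorem castO6 {N N' : ℕ} (hN : 2200 ≤ N) (hNN' : 4 * N ≤ N') :
    ((N' / 2 - N' / 16 + N' / 64 - N - N / 8 - 1 : ℕ) : ℤ) = (N' / 2 : ℕ) - (N' / 16 : ℕ) + (N' / 64 : ℕ) - N - (N / 8 : ℕ) - 1 := by omega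
/-- Arithmetic helper. [folklore] -/
private theorem castO7 {N' : ℕ} (hN' : 64 ≤ N') : ((N' / 16 - 1 : ℕ) : ℤ) = (N' / 16 : ℕ) - 1 := by omega

/-- Arithmetic of the inner bend (floor bookkeeping, proved once in a small context). [folklore] -/
private theorem masterI {m m' i : ℕ} (hm' : 1100 ≤ m') (hmm' : 2 * m' + 1 ≤ m) (hm3 : m ≤ 3 * m') (hi : i < 90) :
    -(sepGlueHeight m : ℤ) + i * ((m / 64 / 2 : ℕ) : ℤ) + (m / 64 / 2 : ℕ) ≤ 0 ∧
    (m' : ℤ) ≤ (m : ℤ) - (m / 8 : ℕ) - (m / 16 : ℕ) - 2 ∧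
    (sepGlueHeight m : ℤ) ≤ (m : ℤ) - (m / 8 : ℕ) - (m / 16 : ℕ) - 2 ∧
    ((m / 64 : ℕ) : ℤ) + (m / 8 : ℕ) ≤ (m / 4 : ℕ) ∧
    ((m / 16 : ℕ) : ℤ) ≤ (m / 8 : ℕ) ∧
    ((m' / 2 : ℕ) : ℤ) + 3 * (m' / 64 : ℕ) ≤ m' ∧
    ((m' / 64 : ℕ) : ℤ) + (m' / 8 : ℕ) ≤ (m' / 2 : ℕ) ∧
    (m' : ℤ) ≤ 2 * (m' / 2 : ℕ) + 1 ∧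
    2 * ((m' / 2 : ℕ) : ℤ) ≤ m' ∧
    2 * ((m' / 64 : ℕ) : ℤ) + 3 ≤ (m' / 8 : ℕ) ∧
    1 + ((m / 16 : ℕ) : ℤ) ≤ (m' / 2 : ℕ) := by
  have hH := sepGlueHeight_cast m
  have hi' : (i : ℤ) * ((m / 64 / 2 : ℕ) : ℤ) ≤ 89 * ((m / 64 / 2 : ℕ) : ℤ) :=
    mul_le_mul_of_nonneg_right (by exact_mod_cast Nat.le_of_lt_succ hi) (by positivity)
  refine ⟨by omega, by omega, by omega, by omega, by omega, by omega, by omega, by omega, by omega, by omega, by omega⟩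

/-- Arithmetic of the outer bend. [folklore] -/
private theorem masterO {N N' j : ℕ} (hN : 2200 ≤ N) (hNN' : 4 * N ≤ N') (hN'N : N' ≤ 32 * N) (hj : j < 90) :
    -(sepGlueHeight N : ℤ) + j * ((N / 64 / 2 : ℕ) : ℤ) + (N / 64 / 2 : ℕ) ≤ 0 ∧
    (sepGlueHeight N : ℤ) ≤ (N : ℤ) + 1 ∧
    ((N / 64 : ℕ) : ℤ) + (N / 8 : ℕ) ≤ (N / 4 : ℕ) ∧
    (N : ℤ) + 1 + 2 * (N / 8 : ℕ) ≤ ((N' / 2 : ℕ) : ℤ) - (N' / 16 : ℕ) + (N' / 64 : ℕ) ∧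
    1 + 2 * ((N / 8 : ℕ) : ℤ) ≤ ((N' / 2 : ℕ) : ℤ) - (N' / 64 : ℕ) ∧
    (N' : ℤ) ≤ 2 * (N' / 2 : ℕ) + 1 ∧
    2 * ((N' / 2 : ℕ) : ℤ) ≤ N' ∧
    ((N' / 64 : ℕ) : ℤ) + (N' / 16 : ℕ) + (N' / 64 : ℕ) + 2 ≤ (N' / 8 : ℕ) ∧
    (N : ℤ) ≤ ((N' / 2 : ℕ) : ℤ) - (N' / 16 : ℕ) ∧
    (1 : ℤ) ≤ (N' / 16 : ℕ) := by
  have hH := sepGlueHeight_cast N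
  have hj' : (j : ℤ) * ((N / 64 / 2 : ℕ) : ℤ) ≤ 89 * ((N / 64 / 2 : ℕ) : ℤ) :=
    mul_le_mul_of_nonneg_right (by exact_mod_cast Nat.le_of_lt_succ hj) (by positivity)
  refine ⟨by omega, by omega, by omega, by omega, by omega, by omega, by omega, by omega, by omega, by omega⟩

/-- The thinned inner free space of the inner bend lies in the inner free space of `sepInCorrQ`. [folklore] -/
theorem inBentFence_subset {m' : ℕ} (hm' : 1100 ≤ m') :
    triStrip ((m' : ℤ) - (m' / 8 : ℕ) + 2 + (m' / 64 : ℕ)) (-((m' / 2 : ℕ) : ℤ) - (m' / 64 : ℕ)) (m' / 8 - 3 - m' / 64) (2 * (m' / 64)) ⊆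
      sepInnerFence m' ![(m' : ℤ), -((m' / 2 : ℕ) : ℤ)] := by
  intro v hv
  refine sepInCorrFence_subset_sepInnerFence (by omega) ?_
  rw [mem_triStrip] at hv ⊢
  rw [castI4 hm'] at hv
  have : ((m' / 8 - 2 : ℕ) : ℤ) = (m' / 8 : ℕ) - 2 := by omega
  rw [this]
  omega

set_option maxHeartbeats 800000 in
/-- **The inner bend glued to the old inner free space.** From the horizontal (in `κ`) crossing of the
old top-side free space through `frameIso 2 u` and `κ ∈ inBent m m'`: a new attaching site `w₆` with a
crossing of the new inner free space of `rotConfig 1 κ` through it, joined to `frameIso 2 u` inside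
`κ` through sites of norm in `[m', m]` or of the new inner attaching ball. [cite: Nolin2008, §4.2 (relocation of landing sequences), §4.3 Prop. 12 (i) (arXiv 0711.4948: Def. 8, Prop. 11)] -/
theorem innerBend_glue {m m' : ℕ} (hm' : 1100 ≤ m') (hmm' : 2 * m' + 1 ≤ m) (hm3 : m ≤ 3 * m')
    {κ : SiteConfig (Site 2)} {z' u b t : Site 2} (hz' : z' ∈ sepLanding m)
    (hb : b 1 = z' 1 - (m / 64 : ℕ)) (ht : t 1 = z' 1 + (m / 64 : ℕ))
    (p₁ : PathIn triGraph (sepInnerFence m z' ∩ frameConfig 2 κ) b u) (p₂ : PathIn triGraph (sepInnerFence m z' ∩ frameConfig 2 κ) u t)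
    (hI : κ ∈ inBent m m') :
    ∃ w₆ : Site 2, OpenVCrossThrough (sepInnerFence m' ![(m' : ℤ), -((m' / 2 : ℕ) : ℤ)])
        (-((m' / 2 : ℕ) : ℤ) - (m' / 64 : ℕ)) (-((m' / 2 : ℕ) : ℤ) + (m' / 64 : ℕ)) (rotConfig 1 κ) w₆ ∧
      PathIn triGraph (shellBall m' m (triRotIsoPow 1 ![(m' : ℤ), -((m' / 2 : ℕ) : ℤ)]) (m' / 8) ∩ κ) (frameIso 2 u) (triRotIsoPow 1 w₆) := by
  have hz'L := hz'; rw [mem_sepLanding] at hz'L; obtain ⟨hz'0, hz'1, hz'2⟩ := hz'L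
  have hHm := sepGlueHeight_cast m
  have hm16 : 64 ≤ m' := by omega
  have hIF := inBentFence_subset hm'
  have c1 : ((m' - m / 8 - 2 : ℕ) : ℤ) = (m' : ℤ) - (m / 8 : ℕ) - 2 := castI1 hm16 hm3
  have c2 : ((m' / 2 + 2 * (m' / 64) - 1 : ℕ) : ℤ) = (m' / 2 : ℕ) + 2 * (m' / 64 : ℕ) - 1 := castI2 hm16
  have c3 : ((m - m' + m' / 64 - m' / 2 : ℕ) : ℤ) = (m : ℤ) - m' + (m' / 64 : ℕ) - (m' / 2 : ℕ) := castI3 hmm'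
  have c4 : ((m' / 8 - 3 - m' / 64 : ℕ) : ℤ) = (m' / 8 : ℕ) - 3 - (m' / 64 : ℕ) := castI4 hm'
  have c5 : ((2 * (m' / 8) - 2 : ℕ) : ℤ) = 2 * (m' / 8 : ℕ) - 2 := castI5 hm16
  have hmz : 2 * (m' : ℤ) + 1 ≤ m := by exact_mod_cast hmm'
  have hm3z : (m : ℤ) ≤ 3 * m' := by exact_mod_cast hm3
  -- the old fence, reflected
  have P₁ := pathIn_of_frameConfig_two p₁
  have σF : ∀ v ∈ frameIso 2 '' sepInnerFence m z', (m : ℤ) - (m / 8 : ℕ) ≤ v 1 ∧ v 1 ≤ (m : ℤ) - 1 ∧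
      z' 1 - (m / 64 : ℕ) ≤ v 0 ∧ v 0 ≤ z' 1 + (m / 64 : ℕ) := by
    rintro _ ⟨w, hw, rfl⟩
    rw [mem_sepInnerFence] at hw
    obtain ⟨e0, e1⟩ := frameIso2_apply w
    exact ⟨e1 ▸ hw.1, e1 ▸ hw.2.1, e0 ▸ hw.2.2.1, e0 ▸ hw.2.2.2⟩
  obtain ⟨eb0, -⟩ := frameIso2_apply b
  obtain ⟨et0, -⟩ := frameIso2_apply t
  have PF := pathIn_of_frameConfig_two (p₁.trans p₂)
  -- the corridor
  obtain ⟨⟨⟨⟨⟨⟨⟨hF6, hIJ⟩, hIC⟩, hI5⟩, hI4⟩, hI3⟩, hI2⟩, hIG⟩ := hI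
  obtain ⟨bj, tj, hbj, htj, PJ⟩ := hIJ
  obtain ⟨ac, ec, hac, hec, PC⟩ := hIC
  obtain ⟨b₅, t₅, hb₅, ht₅, PB3⟩ := hI5
  obtain ⟨a₄, e₄, ha₄, he₄, PH2⟩ := hI4
  obtain ⟨bv, tv, hbv, htv, PV1⟩ := hI3
  obtain ⟨ah, eh, hah, heh, PHW⟩ := hI2
  obtain ⟨i, hi, hgi1, hgi2⟩ := exists_sepInComb_rows (by omega : 2200 ≤ m) hz'
  obtain ⟨g₀, g₁, hg₀, hg₁, PG⟩ := (Set.mem_iInter₂.1 hIG) i (Finset.mem_range.2 hi)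
  obtain ⟨b₀, t₀, hb₀, ht₀, PV⟩ := hF6
  simp only [Nat.cast_add, Nat.cast_one, Nat.cast_mul, Nat.cast_ofNat] at hg₁ heh htv ht₀ hec htj
  rw [c5] at htj; rw [c3] at ht₅; rw [c2] at he₄; rw [c1] at htv
  have hih : (0 : ℤ) ≤ (i : ℤ) * ((m / 64 / 2 : ℕ) : ℤ) := by positivity
  have hih' : (i : ℤ) * ((m / 64 / 2 : ℕ) : ℤ) ≤ 89 * ((m / 64 / 2 : ℕ) : ℤ) :=
    mul_le_mul_of_nonneg_right (by exact_mod_cast Nat.le_of_lt_succ hi) (by positivity)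
  have hm2200 : (2200 : ℤ) ≤ m := by exact_mod_cast (show 2200 ≤ m by omega)
  obtain ⟨kG, kR, kS, k64, k16, kp, kp2, kp3, kp4, kp5, kq⟩ := masterI (i := i) hm' hmm' hm3 hi
  -- hide the integer divisions from `linarith`
  have F8 := flz m 8 (by norm_num); have F16 := flz m 16 (by norm_num); have F4 := flz m 4 (by norm_num)
  have F64 := flz m 64 (by norm_num); have Fh := flz (m / 64) 2 (by norm_num)
  have G2 := flz m' 2 (by norm_num); have G8 := flz m' 8 (by norm_num); have G64 := flz m' 64 (by norm_num)
  generalize eq8 : m / 8 = q8 at *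
  generalize eq16 : m / 16 = q16 at *
  generalize eq4 : m / 4 = q4 at *
  generalize eq64 : m / 64 = q64 at *
  generalize eqh : q64 / 2 = qh at *
  generalize ep2 : m' / 2 = p2 at *
  generalize ep8 : m' / 8 = p8 at *
  generalize ep64 : m' / 64 = p64 at *
  clear eq8 eq16 eq4 eq64 eqh ep2 ep8 ep64
  push_cast at F8 F16 F4 F64 Fh G2 G8 G64
  have kG0 : (0 : ℤ) ≤ sepGlueHeight m := by positivity
  have n8 : (0 : ℤ) ≤ q8 := by positivity
  have n16 : (0 : ℤ) ≤ q16 := by positivity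
  have n64 : (0 : ℤ) ≤ q64 := by positivity
  have nh : (0 : ℤ) ≤ qh := by positivity
  have n2' : (0 : ℤ) ≤ p2 := by positivity
  have n8' : (0 : ℤ) ≤ p8 := by positivity
  have n64' : (0 : ℤ) ≤ p64 := by positivity
  -- J1: the old fence crossing (horizontal in `κ`) meets the comb strip `i`
  have Q1 := PathIn.relay (L := -(sepGlueHeight m : ℤ) + i * (qh : ℤ)) (R := -(sepGlueHeight m : ℤ) + i * (qh : ℤ) + qh)
    (B := (m : ℤ) - q8) (T := (m : ℤ) - 1) (by linarith) (by linarith) PF (by rw [eb0]; linarith) (by rw [et0]; linarith)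
    (fun v hv _ _ => ⟨(σF v hv).1, (σF v hv).2.1⟩) PG (by linarith) (by linarith)
    (fun v hv _ _ => by rw [mem_triStrip] at hv; exact ⟨by linarith [hv.1], by linarith [hv.2.1]⟩)
  -- J2: the comb strip meets the highway
  have Q2 := PathIn.relay (L := -(sepGlueHeight m : ℤ) + i * (qh : ℤ)) (R := -(sepGlueHeight m : ℤ) + i * (qh : ℤ) + qh)
    (B := (m : ℤ) - q8 - q16 - 2) (T := (m : ℤ) - q8 - 2) (by linarith) (by linarith) PHW (by linarith) (by linarith)
    (fun v hv _ _ => by rw [mem_triStrip] at hv; exact ⟨by linarith [hv.2.2.1], by linarith [hv.2.2.2]⟩) PG hg₀.le (by linarith)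
    (fun v hv _ _ => by rw [mem_triStrip] at hv; exact ⟨by linarith [hv.1], by linarith [hv.2.1]⟩)
  -- J3: the highway meets the descent
  have Q3 := PathIn.relay (L := (1 : ℤ)) (R := 1 + q16)
    (B := (m : ℤ) - q8 - q16 - 2) (T := (m : ℤ) - q8 - 2) (by linarith) (by linarith) PHW (by linarith) (by linarith)
    (fun v hv _ _ => by rw [mem_triStrip] at hv; exact ⟨by linarith [hv.2.2.1], by linarith [hv.2.2.2]⟩) PV1 (by linarith) (by linarith)
    (fun v hv _ _ => by rw [mem_triStrip] at hv; exact ⟨by linarith [hv.1], by linarith [hv.2.1]⟩)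
  -- J4: the traverse meets the descent
  have Q4 := PathIn.relay (L := (1 : ℤ)) (R := 1 + q16)
    (B := (m : ℤ) - m') (T := (m : ℤ) - m' + p64) (by linarith) (by linarith) PH2 (by linarith) (by linarith)
    (fun v hv _ _ => by rw [mem_triStrip] at hv; exact ⟨by linarith [hv.2.2.1], by linarith [hv.2.2.2]⟩) PV1 hbv.le (by linarith)
    (fun v hv _ _ => by rw [mem_triStrip] at hv; exact ⟨by linarith [hv.1], by linarith [hv.2.1]⟩)
  -- J5: the traverse meets the approach
  have Q5 := PathIn.relay (L := (p2 : ℤ)) (R := (p2 : ℤ) + 2 * p64)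
    (B := (m : ℤ) - m') (T := (m : ℤ) - m' + p64) (by linarith) (by linarith) PH2 (by linarith) (by linarith [he₄])
    (fun v hv _ _ => by rw [mem_triStrip] at hv; exact ⟨by linarith [hv.2.2.1], by linarith [hv.2.2.2]⟩) PB3 (by linarith) (by linarith)
    (fun v hv _ _ => by rw [mem_triStrip] at hv; push_cast at hv; exact ⟨by linarith [hv.1], by linarith [hv.2.1]⟩)
  -- J5b: the connector meets the approach
  have Q6 := PathIn.relay (L := (p2 : ℤ)) (R := (p2 : ℤ) + 2 * p64)
    (B := (p2 : ℤ)) (T := (p2 : ℤ) + p8) (by linarith) (by linarith) PC (by linarith) (by linarith [hec])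
    (fun v hv _ _ => by rw [mem_triStrip] at hv; exact ⟨by linarith [hv.2.2.1], by linarith [hv.2.2.2]⟩) PB3 (by linarith) (by linarith)
    (fun v hv _ _ => by rw [mem_triStrip] at hv; push_cast at hv; exact ⟨by linarith [hv.1], by linarith [hv.2.1]⟩)
  -- J5c: the connector meets the junction box
  have Q7 := PathIn.relay (L := (p2 : ℤ)) (R := (p2 : ℤ) + p64)
    (B := (p2 : ℤ)) (T := (p2 : ℤ) + p8) (by linarith) (by linarith) PC (by linarith) (by linarith [hec])
    (fun v hv _ _ => by rw [mem_triStrip] at hv; exact ⟨by linarith [hv.2.2.1], by linarith [hv.2.2.2]⟩) PJ (by linarith) (by linarith)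
    (fun v hv _ _ => by rw [mem_triStrip] at hv; exact ⟨by linarith [hv.1], by linarith [hv.2.1]⟩)
  -- J6: the junction box meets the new inner free space (read in the frame `1`)
  obtain ⟨SV, hSV, PV', TV⟩ := PV.exists_support
  have PVκ : PathIn triGraph ((triRotIsoPow 1 '' SV) ∩ κ) (triRotIsoPow 1 t₀) (triRotIsoPow 1 b₀) := by
    have h := PV'.symm.mono (show SV ⊆ SV ∩ rotConfig 1 κ from fun v hv => ⟨hv, (hSV hv).2⟩)
    exact pathIn_of_rotConfig_one h
  obtain ⟨S₅, hS₅, PJ', T₅⟩ := PJ.exists_support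
  obtain ⟨rb0, -⟩ := rot1_apply b₀
  obtain ⟨rt0, -⟩ := rot1_apply t₀
  obtain ⟨p₆, hp₆V, hp₆B⟩ := exists_mem_of_cross (L := (p2 : ℤ)) (R := (p2 : ℤ) + p64)
    (B := (m' : ℤ) - p2 - p8 + 2) (T := (m' : ℤ) - p2 - 1) (by linarith) (by linarith)
    PVκ (by rw [rt0, ht₀]; linarith) (by rw [rb0, hb₀]; linarith)
    (fun v hv hL hR => by
      obtain ⟨w, hw, hwv⟩ := hv.1
      have h := (hSV hw).1
      rw [mem_triStrip, c4] at h
      push_cast at h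
      obtain ⟨r0, r1⟩ := rot1_apply w
      have hv0 : v 0 = -w 1 := by rw [← hwv]; exact r0
      have hv1 : v 1 = w 0 + w 1 := by rw [← hwv]; exact r1
      constructor <;> linarith)
    PJ' (by linarith [hbj]) (by linarith [htj])
    (fun v hv _ _ => by have h := (hS₅ hv).1; rw [mem_triStrip] at h; exact ⟨by linarith [h.1], by linarith [h.2.1]⟩)
  obtain ⟨w₆, hw₆, hw₆p⟩ : ∃ w₆ ∈ SV, triRotIsoPow 1 w₆ = p₆ := by
    obtain ⟨w, hw, hwp⟩ := hp₆V.1; exact ⟨w, hw, hwp⟩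
  set z'new : Site 2 := ![(m' : ℤ), -((p2 : ℕ) : ℤ)] with hz'new
  have hSVF : SV ⊆ sepInnerFence m' z'new ∩ rotConfig 1 κ := fun v hv => ⟨hIF (hSV hv).1, (hSV hv).2⟩
  have hFenceIn : OpenVCrossThrough (sepInnerFence m' z'new) (-((p2 : ℕ) : ℤ) - (p64 : ℕ)) (-((p2 : ℕ) : ℤ) + (p64 : ℕ)) (rotConfig 1 κ) w₆ :=
    ⟨b₀, t₀, hb₀, by rw [ht₀]; ring, (TV w₆ hw₆).mono hSVF, ((TV w₆ hw₆).symm.trans (TV t₀ PV'.right_mem)).mono hSVF⟩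
  refine ⟨w₆, hFenceIn, ?_⟩
  -- the regions
  obtain ⟨zn'0, zn'1⟩ := rot1_apply z'new
  have ez0 : z'new 0 = m' := site_mk_apply_zero _ _
  have ez1 : z'new 1 = -((p2 : ℕ) : ℤ) := site_mk_apply_one _ _
  rw [ez0, ez1] at zn'1; rw [ez1] at zn'0
  have inG : triStrip (-(sepGlueHeight m : ℤ) + i * (qh : ℤ)) ((m : ℤ) - q8 - q16 - 2) qh (q8 + q16 + 1) ⊆
      shellBall m' m (triRotIsoPow 1 z'new) p8 := fun v hv => by
    rw [mem_triStrip] at hv; push_cast at hv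
    exact mem_shell_of_topSector (by linarith) (by linarith) (by linarith) (by linarith)
  have inF : frameIso 2 '' sepInnerFence m z' ⊆ shellBall m' m (triRotIsoPow 1 z'new) p8 := fun v hv => by
    obtain ⟨f1, f2, f3, f4⟩ := σF v hv
    exact mem_shell_of_topSector (by linarith) (by linarith) (by linarith) (by linarith)
  have inHW : triStrip (-(sepGlueHeight m : ℤ)) ((m : ℤ) - q8 - q16 - 2) (sepGlueHeight m + 1 + q16) q16 ⊆
      shellBall m' m (triRotIsoPow 1 z'new) p8 := by
    intro v hv; rw [mem_triStrip] at hv; push_cast at hv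
    rcases le_or_gt (v 0) 0 with h | h
    · exact mem_shell_of_topSector (by linarith) (by linarith) h (by linarith)
    · exact mem_shell_of_quadrant (by linarith) (by linarith) h.le (by linarith)
  have inV1 : triStrip 1 ((m : ℤ) - m') q16 (m' - q8 - 2) ⊆ shellBall m' m (triRotIsoPow 1 z'new) p8 := fun v hv => by
    rw [mem_triStrip, c1] at hv
    exact mem_shell_of_quadrant (by linarith) (by linarith) (by linarith) (by linarith)
  have inH2 : triStrip 1 ((m : ℤ) - m') (p2 + 2 * p64 - 1) p64 ⊆ shellBall m' m (triRotIsoPow 1 z'new) p8 := fun v hv => by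
    rw [mem_triStrip, c2] at hv
    exact mem_shell_of_quadrant (by linarith) (by linarith) (by linarith) (by linarith)
  -- the three boxes near the new attaching ball: annulus part or ball
  have near : ∀ v : Site 2, (p2 : ℤ) ≤ v 0 → v 0 ≤ p2 + 2 * p64 → (p2 : ℤ) - p8 + 2 ≤ v 1 → v 1 ≤ (m : ℤ) - m' + p64 →
      v ∈ shellBall m' m (triRotIsoPow 1 z'new) p8 := by
    intro v h1 h2 h3 h4
    rcases le_or_gt (m' : ℤ) (v 0 + v 1) with h | h
    · exact mem_shell_of_quadrant h (by linarith) (by linarith) (by linarith)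
    · exact mem_shell_of_near (by rw [zn'0]; linarith) (by rw [zn'0]; linarith) (by rw [zn'1]; linarith)
        (by rw [zn'1]; linarith) (by rw [zn'0, zn'1]; linarith) (by rw [zn'0, zn'1]; linarith)
  have inB3 : triStrip ((p2 : ℕ) : ℤ) ((p2 : ℕ) : ℤ) (2 * p64) (m - m' + p64 - p2) ⊆ shellBall m' m (triRotIsoPow 1 z'new) p8 := by
    intro v hv; rw [mem_triStrip, c3] at hv; push_cast at hv
    exact near v hv.1 hv.2.1 (by linarith) (by linarith)
  have inC : triStrip ((p2 : ℕ) : ℤ) ((p2 : ℕ) : ℤ) (2 * p64) p8 ⊆ shellBall m' m (triRotIsoPow 1 z'new) p8 := by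
    intro v hv; rw [mem_triStrip] at hv; push_cast at hv
    exact near v hv.1 hv.2.1 (by linarith) (by linarith)
  have inJ : triStrip ((p2 : ℕ) : ℤ) ((p2 : ℤ) - p8 + 2) p64 (2 * p8 - 2) ⊆ shellBall m' m (triRotIsoPow 1 z'new) p8 := by
    intro v hv; rw [mem_triStrip, c5] at hv
    exact near v hv.1 (by linarith) hv.2.2.1 (by linarith)
  have m2 : ∀ {A B : Set (Site 2)}, A ⊆ shellBall m' m (triRotIsoPow 1 z'new) p8 → B ⊆ shellBall m' m (triRotIsoPow 1 z'new) p8 →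
      (A ∪ B) ∩ κ ⊆ shellBall m' m (triRotIsoPow 1 z'new) p8 ∩ κ := fun hA hB v hv =>
    ⟨hv.1.elim (fun h => hA h) (fun h => hB h), hv.2⟩
  have K8 : PathIn triGraph (shellBall m' m (triRotIsoPow 1 z'new) p8 ∩ κ) bj p₆ :=
    (T₅ p₆ hp₆B).mono fun v hv => ⟨inJ (hS₅ hv).1, (hS₅ hv).2⟩
  have K7 := Q7.mono (m2 inC inJ)
  have K6 := Q6.mono (m2 inC inB3)
  have K5 := Q5.mono (m2 inH2 inB3)
  have K4 := Q4.mono (m2 inH2 inV1)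
  have K3 := Q3.mono (m2 inHW inV1)
  have K2 := Q2.mono (m2 inHW inG)
  have K1 := Q1.mono (m2 inF inG)
  have K0 : PathIn triGraph (shellBall m' m (triRotIsoPow 1 z'new) p8 ∩ κ) (frameIso 2 b) (frameIso 2 u) :=
    P₁.mono fun v hv => ⟨inF hv.1, hv.2⟩
  rw [hw₆p]
  exact ((((((((K0.symm.trans K1).trans K2.symm).trans K3).trans K4.symm).trans K5).trans K6.symm).trans K7).trans K8)

set_option maxHeartbeats 800000 in
/-- **The outer bend glued to the old outer free space.** From the horizontal (in `κ`) crossing of the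
old top-side outer free space through `frameIso 2 u'` and `κ ∈ outBent N N'`: a new outer attaching
site `w₇` with a crossing of the new outer free space of `rotConfig 1 κ` through it, joined to
`frameIso 2 u'` inside `κ` through sites of norm in `[N, N']` or of the new outer attaching ball. [cite: Nolin2008, §4.2 (relocation of landing sequences), §4.3 Prop. 12 (i) (arXiv 0711.4948: Def. 8, Prop. 11)] -/
theorem outerBend_glue {N N' : ℕ} (hN : 2200 ≤ N) (hNN' : 4 * N ≤ N') (hN'N : N' ≤ 32 * N)
    {κ : SiteConfig (Site 2)} {z u' b' t' : Site 2} (hz : z ∈ sepLanding N)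
    (hb' : b' 1 = z 1 - (N / 64 : ℕ)) (ht' : t' 1 = z 1 + (N / 64 : ℕ))
    (p₃ : PathIn triGraph (sepOuterFence N z ∩ frameConfig 2 κ) b' u') (p₄ : PathIn triGraph (sepOuterFence N z ∩ frameConfig 2 κ) u' t')
    (hO : κ ∈ outBent N N') :
    ∃ w₇ : Site 2, OpenVCrossThrough (sepOuterFence N' ![(N' : ℤ), -((N' / 2 : ℕ) : ℤ)])
        (-((N' / 2 : ℕ) : ℤ) - (N' / 64 : ℕ)) (-((N' / 2 : ℕ) : ℤ) + (N' / 64 : ℕ)) (rotConfig 1 κ) w₇ ∧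
      PathIn triGraph (shellBall N N' (triRotIsoPow 1 ![(N' : ℤ), -((N' / 2 : ℕ) : ℤ)]) (N' / 8) ∩ κ) (frameIso 2 u') (triRotIsoPow 1 w₇) := by
  have hzL := hz; rw [mem_sepLanding] at hzL; obtain ⟨hz0, hz1, hz2⟩ := hzL
  have hHN := sepGlueHeight_cast N
  have hN'16 : 64 ≤ N' := by omega
  have hOF := sepOutCorrFence_subset_sepOuterFence (R' := N') (by omega : 16 ≤ N')
  have c5 : ((N' / 2 - 1 : ℕ) : ℤ) = (N' / 2 : ℕ) - 1 := castO5 hN'16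
  have c6 : ((N' / 2 - N' / 16 + N' / 64 - N - N / 8 - 1 : ℕ) : ℤ) = (N' / 2 : ℕ) - (N' / 16 : ℕ) + (N' / 64 : ℕ) - N - (N / 8 : ℕ) - 1 :=
    castO6 hN hNN'
  have c7 : ((N' / 16 - 1 : ℕ) : ℤ) = (N' / 16 : ℕ) - 1 := castO7 hN'16
  have hNN : 4 * (N : ℤ) ≤ N' := by exact_mod_cast hNN'
  have hN'N' : (N' : ℤ) ≤ 32 * N := by exact_mod_cast hN'N
  have P₃ := pathIn_of_frameConfig_two p₃
  have σO : ∀ v ∈ frameIso 2 '' sepOuterFence N z, (N : ℤ) + 1 ≤ v 1 ∧ v 1 ≤ (N : ℤ) + (N / 8 : ℕ) ∧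
      z 1 - (N / 64 : ℕ) ≤ v 0 ∧ v 0 ≤ z 1 + (N / 64 : ℕ) := by
    rintro _ ⟨w, hw, rfl⟩
    rw [mem_sepOuterFence] at hw
    obtain ⟨e0, e1⟩ := frameIso2_apply w
    exact ⟨e1 ▸ hw.1, e1 ▸ hw.2.1, e0 ▸ hw.2.2.1, e0 ▸ hw.2.2.2⟩
  obtain ⟨eb'0, -⟩ := frameIso2_apply b'
  obtain ⟨et'0, -⟩ := frameIso2_apply t'
  have PF := pathIn_of_frameConfig_two (p₃.trans p₄)
  obtain ⟨⟨⟨⟨⟨hO6, hO5⟩, hO4⟩, hO3⟩, hO2⟩, hOG⟩ := hO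
  obtain ⟨ob₅, ot₅, hob₅, hot₅, OB3⟩ := hO5
  obtain ⟨oa₄, oe₄, hoa₄, hoe₄, OH2⟩ := hO4
  obtain ⟨obv, otv, hobv, hotv, OV1⟩ := hO3
  obtain ⟨oah, oeh, hoah, hoeh, OHW⟩ := hO2
  obtain ⟨j, hj, hgj1, hgj2⟩ := exists_sepInComb_rows hN hz
  obtain ⟨og₀, og₁, hog₀, hog₁, OG⟩ := (Set.mem_iInter₂.1 hOG) j (Finset.mem_range.2 hj)
  obtain ⟨ob₀, ot₀, hob₀, hot₀, OV⟩ := hO6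
  simp only [Nat.cast_add, Nat.cast_one, Nat.cast_mul, Nat.cast_ofNat] at hog₁ hoeh hotv hot₅ hot₀
  rw [c6] at hotv; rw [c5] at hoe₄
  have hjh : (0 : ℤ) ≤ (j : ℤ) * ((N / 64 / 2 : ℕ) : ℤ) := by positivity
  have hjh' : (j : ℤ) * ((N / 64 / 2 : ℕ) : ℤ) ≤ 89 * ((N / 64 / 2 : ℕ) : ℤ) :=
    mul_le_mul_of_nonneg_right (by exact_mod_cast Nat.le_of_lt_succ hj) (by positivity)
  have hN2200 : (2200 : ℤ) ≤ N := by exact_mod_cast hN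
  obtain ⟨kG, kS, k64, kA, kq, kp3, kp4, kp5, kp6, kp7⟩ := masterO (j := j) hN hNN' hN'N hj
  -- hide the integer divisions from `linarith`
  have F8 := flz N 8 (by norm_num); have F4 := flz N 4 (by norm_num)
  have F64 := flz N 64 (by norm_num); have Fh := flz (N / 64) 2 (by norm_num)
  have G2 := flz N' 2 (by norm_num); have G8 := flz N' 8 (by norm_num); have G16 := flz N' 16 (by norm_num)
  have G64 := flz N' 64 (by norm_num)
  generalize eq8 : N / 8 = q8 at *
  generalize eq4 : N / 4 = q4 at *
  generalize eq64 : N / 64 = q64 at *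
  generalize eqh : q64 / 2 = qh at *
  generalize ep2 : N' / 2 = p2 at *
  generalize ep8 : N' / 8 = p8 at *
  generalize ep16 : N' / 16 = p16 at *
  generalize ep64 : N' / 64 = p64 at *
  clear eq8 eq4 eq64 eqh ep2 ep8 ep16 ep64
  push_cast at F8 F4 F64 Fh G2 G8 G16 G64
  have kp8 : (0 : ℤ) ≤ p64 := by positivity
  have kG0 : (0 : ℤ) ≤ sepGlueHeight N := by positivity
  have kq8 : (0 : ℤ) ≤ q8 := by positivity
  have n64 : (0 : ℤ) ≤ q64 := by positivity
  have nh : (0 : ℤ) ≤ qh := by positivity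
  have n2' : (0 : ℤ) ≤ p2 := by positivity
  have n8' : (0 : ℤ) ≤ p8 := by positivity
  have n16' : (0 : ℤ) ≤ p16 := by positivity
  -- J1': the old outer fence crossing meets the comb strip `j`
  have R1 := PathIn.relay (L := -(sepGlueHeight N : ℤ) + j * (qh : ℤ)) (R := -(sepGlueHeight N : ℤ) + j * (qh : ℤ) + qh)
    (B := (N : ℤ) + 1) (T := (N : ℤ) + q8) (by linarith) (by linarith) PF (by rw [eb'0]; linarith) (by rw [et'0]; linarith)
    (fun v hv _ _ => ⟨(σO v hv).1, (σO v hv).2.1⟩) OG hog₀.le (by linarith)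
    (fun v hv _ _ => by rw [mem_triStrip] at hv; exact ⟨by linarith [hv.1], by linarith [hv.2.1]⟩)
  -- J2': the comb strip meets the highway
  have R2 := PathIn.relay (L := -(sepGlueHeight N : ℤ) + j * (qh : ℤ)) (R := -(sepGlueHeight N : ℤ) + j * (qh : ℤ) + qh)
    (B := (N : ℤ) + q8 + 1) (T := (N : ℤ) + 1 + 2 * q8) (by linarith) (by linarith) OHW (by linarith) (by linarith [hoeh])
    (fun v hv _ _ => by rw [mem_triStrip] at hv; exact ⟨by linarith [hv.2.2.1], by linarith [hv.2.2.2]⟩) OG (by linarith) (by linarith)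
    (fun v hv _ _ => by rw [mem_triStrip] at hv; exact ⟨by linarith [hv.1], by linarith [hv.2.1]⟩)
  -- J3': the highway meets the ascent
  have R3 := PathIn.relay (L := (1 : ℤ)) (R := 1 + 2 * q8)
    (B := (N : ℤ) + q8 + 1) (T := (N : ℤ) + 1 + 2 * q8) (by linarith) (by linarith) OHW (by linarith) (by linarith [hoeh])
    (fun v hv _ _ => by rw [mem_triStrip] at hv; exact ⟨by linarith [hv.2.2.1], by linarith [hv.2.2.2]⟩) OV1 hobv.le (by linarith)
    (fun v hv _ _ => by rw [mem_triStrip] at hv; push_cast at hv; exact ⟨by linarith [hv.1], by linarith [hv.2.1]⟩)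
  -- J4': the traverse meets the ascent
  have R4 := PathIn.relay (L := (1 : ℤ)) (R := 1 + 2 * q8)
    (B := (p2 : ℤ) - p16) (T := (p2 : ℤ) - p16 + p64) (by linarith) (by linarith) OH2 (by linarith) (by linarith [hoe₄])
    (fun v hv _ _ => by rw [mem_triStrip] at hv; exact ⟨by linarith [hv.2.2.1], by linarith [hv.2.2.2]⟩) OV1 (by linarith) (by linarith)
    (fun v hv _ _ => by rw [mem_triStrip] at hv; push_cast at hv; exact ⟨by linarith [hv.1], by linarith [hv.2.1]⟩)
  -- J5': the traverse meets the approach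
  have R5 := PathIn.relay (L := (p2 : ℤ) - p64) (R := (p2 : ℤ))
    (B := (p2 : ℤ) - p16) (T := (p2 : ℤ) - p16 + p64) (by linarith) (by linarith) OH2 (by linarith) (by linarith)
    (fun v hv _ _ => by rw [mem_triStrip] at hv; exact ⟨by linarith [hv.2.2.1], by linarith [hv.2.2.2]⟩) OB3 hob₅.le (by linarith)
    (fun v hv _ _ => by rw [mem_triStrip] at hv; exact ⟨by linarith [hv.1], by linarith [hv.2.1]⟩)
  -- J6': the approach meets the new outer free space (read in the frame `1`)
  obtain ⟨SW, hSW, OV', TW⟩ := OV.exists_support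
  have OVκ : PathIn triGraph ((triRotIsoPow 1 '' SW) ∩ κ) (triRotIsoPow 1 ot₀) (triRotIsoPow 1 ob₀) := by
    have h := OV'.symm.mono (show SW ⊆ SW ∩ rotConfig 1 κ from fun v hv => ⟨hv, (hSW hv).2⟩)
    exact pathIn_of_rotConfig_one h
  obtain ⟨S₈, hS₈, OB3', T₈⟩ := OB3.exists_support
  obtain ⟨sb0, -⟩ := rot1_apply ob₀
  obtain ⟨st0, -⟩ := rot1_apply ot₀
  obtain ⟨p₇, hp₇V, hp₇B⟩ := exists_mem_of_cross (L := (p2 : ℤ) - p64) (R := (p2 : ℤ))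
    (B := (N' : ℤ) - p2 + 1) (T := (N' : ℤ) - p2 + p16 + p64) (by linarith) (by linarith)
    OVκ (by rw [st0, hot₀]; linarith) (by rw [sb0, hob₀]; linarith)
    (fun v hv hL hR => by
      obtain ⟨w, hw, hwv⟩ := hv.1
      have h := (hSW hw).1
      rw [mem_triStrip, c7] at h
      push_cast at h
      obtain ⟨r0, r1⟩ := rot1_apply w
      have hv0 : v 0 = -w 1 := by rw [← hwv]; exact r0
      have hv1 : v 1 = w 0 + w 1 := by rw [← hwv]; exact r1
      constructor <;> linarith)
    OB3' (by linarith [hob₅]) (by linarith [hot₅])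
    (fun v hv _ _ => by have h := (hS₈ hv).1; rw [mem_triStrip] at h; exact ⟨by linarith [h.1], by linarith [h.2.1]⟩)
  obtain ⟨w₇, hw₇, hw₇p⟩ : ∃ w₇ ∈ SW, triRotIsoPow 1 w₇ = p₇ := by
    obtain ⟨w, hw, hwp⟩ := hp₇V.1; exact ⟨w, hw, hwp⟩
  set znew : Site 2 := ![(N' : ℤ), -((p2 : ℕ) : ℤ)] with hznew
  have hSWF : SW ⊆ sepOuterFence N' znew ∩ rotConfig 1 κ := fun v hv => ⟨hOF (hSW hv).1, (hSW hv).2⟩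
  have hFenceOut : OpenVCrossThrough (sepOuterFence N' znew) (-((p2 : ℕ) : ℤ) - (p64 : ℕ)) (-((p2 : ℕ) : ℤ) + (p64 : ℕ)) (rotConfig 1 κ) w₇ :=
    ⟨ob₀, ot₀, hob₀, by rw [hot₀]; ring, (TW w₇ hw₇).mono hSWF, ((TW w₇ hw₇).symm.trans (TW ot₀ OV'.right_mem)).mono hSWF⟩
  refine ⟨w₇, hFenceOut, ?_⟩
  obtain ⟨zn0, zn1⟩ := rot1_apply znew
  have ez0 : znew 0 = N' := site_mk_apply_zero _ _
  have ez1 : znew 1 = -((p2 : ℕ) : ℤ) := site_mk_apply_one _ _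
  rw [ez0, ez1] at zn1; rw [ez1] at zn0
  have outG : triStrip (-(sepGlueHeight N : ℤ) + j * (qh : ℤ)) ((N : ℤ) + 1) qh (2 * q8) ⊆ shellBall N N' (triRotIsoPow 1 znew) p8 :=
    fun v hv => by
      rw [mem_triStrip] at hv; push_cast at hv
      exact mem_shell_of_topSector (by linarith) (by linarith) (by linarith) (by linarith)
  have outF : frameIso 2 '' sepOuterFence N z ⊆ shellBall N N' (triRotIsoPow 1 znew) p8 := fun v hv => by
    obtain ⟨f1, f2, f3, f4⟩ := σO v hv
    exact mem_shell_of_topSector (by linarith) (by linarith) (by linarith) (by linarith)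
  have outHW : triStrip (-(sepGlueHeight N : ℤ)) ((N : ℤ) + q8 + 1) (sepGlueHeight N + 1 + 2 * q8) q8 ⊆ shellBall N N' (triRotIsoPow 1 znew) p8 := by
    intro v hv; rw [mem_triStrip] at hv; push_cast at hv
    rcases le_or_gt (v 0) 0 with h | h
    · exact mem_shell_of_topSector (by linarith) (by linarith) h (by linarith)
    · exact mem_shell_of_quadrant (by linarith) (by linarith) h.le (by linarith)
  have outV1 : triStrip 1 ((N : ℤ) + q8 + 1) (2 * q8) (p2 - p16 + p64 - N - q8 - 1) ⊆ shellBall N N' (triRotIsoPow 1 znew) p8 :=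
    fun v hv => by
      rw [mem_triStrip, c6] at hv; push_cast at hv
      exact mem_shell_of_quadrant (by linarith) (by linarith) (by linarith) (by linarith)
  have outH2 : triStrip 1 ((p2 : ℤ) - p16) (p2 - 1) p64 ⊆ shellBall N N' (triRotIsoPow 1 znew) p8 := fun v hv => by
    rw [mem_triStrip, c5] at hv
    exact mem_shell_of_quadrant (by linarith) (by linarith) (by linarith) (by linarith)
  have outB3 : triStrip ((p2 : ℤ) - p64) ((p2 : ℤ) - p16) p64 (2 * p16 + p64 + 1) ⊆ shellBall N N' (triRotIsoPow 1 znew) p8 := by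
    intro v hv; rw [mem_triStrip] at hv; push_cast at hv
    rcases le_or_gt (v 0 + v 1) (N' : ℤ) with h | h
    · exact mem_shell_of_quadrant (by linarith) h (by linarith) (by linarith)
    · exact mem_shell_of_near (by rw [zn0]; linarith) (by rw [zn0]; linarith) (by rw [zn1]; linarith)
        (by rw [zn1]; linarith) (by rw [zn0, zn1]; linarith) (by rw [zn0, zn1]; linarith)
  have m2 : ∀ {A B : Set (Site 2)}, A ⊆ shellBall N N' (triRotIsoPow 1 znew) p8 → B ⊆ shellBall N N' (triRotIsoPow 1 znew) p8 →
      (A ∪ B) ∩ κ ⊆ shellBall N N' (triRotIsoPow 1 znew) p8 ∩ κ := fun hA hB v hv =>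
    ⟨hv.1.elim (fun h => hA h) (fun h => hB h), hv.2⟩
  have L0 : PathIn triGraph (shellBall N N' (triRotIsoPow 1 znew) p8 ∩ κ) (frameIso 2 b') (frameIso 2 u') :=
    P₃.mono fun v hv => ⟨outF hv.1, hv.2⟩
  have L1 := R1.mono (m2 outF outG)
  have L2 := R2.mono (m2 outHW outG)
  have L3 := R3.mono (m2 outHW outV1)
  have L4 := R4.mono (m2 outH2 outV1)
  have L5 := R5.mono (m2 outH2 outB3)
  have L6 : PathIn triGraph (shellBall N N' (triRotIsoPow 1 znew) p8 ∩ κ) ob₅ p₇ :=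
    (T₈ p₇ hp₇B).mono fun v hv => ⟨outB3 (hS₈ hv).1, (hS₈ hv).2⟩
  rw [hw₇p]
  exact (((((L0.symm.trans L1).trans L2.symm).trans L3).trans L4.symm).trans L5).trans L6

/-- **Re-fencing a closed arm from the reflection frame of the top side to the rotation frame of the
side `1`.** For `1100 ≤ m'`, `2m' + 1 ≤ m ≤ 3m'`, `2200 ≤ N`, `2m ≤ N`, `4N ≤ N' ≤ 32N`: if the top-side
reflection `frameConfig 2 κ` of `κ` has a fenced arm at the scales `(m, N)` and `κ` crosses the two
bends, then `rotConfig 1 κ` has a fenced arm at the scales `(m', N')`. [cite: Nolin2008, §4.2 (relocation of landing sequences), §4.3 Prop. 12 (i) (arXiv 0711.4948: Def. 8, Prop. 11); §4.4 p. 13] -/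
theorem closedArm_halfStep {m m' N N' : ℕ} (hm' : 1100 ≤ m') (hmm' : 2 * m' + 1 ≤ m) (hm3 : m ≤ 3 * m')
    (hN : 2200 ≤ N) (hmN : 2 * m ≤ N) (hNN' : 4 * N ≤ N') (hN'N : N' ≤ 32 * N) {κ : SiteConfig (Site 2)}
    (hC : frameConfig 2 κ ∈ sepOpenArm m N) (hI : κ ∈ inBent m m') (hO : κ ∈ outBent N N') :
    rotConfig 1 κ ∈ sepOpenArm m' N' := by
  obtain ⟨z, z', u, u', hz, hz', ⟨b, t, hb, ht, p₁, p₂⟩, ⟨b', t', hb', ht', p₃, p₄⟩, p₅⟩ := hC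
  obtain ⟨w₆, hFenceIn, PI⟩ := innerBend_glue hm' hmm' hm3 hz' hb ht p₁ p₂ hI
  obtain ⟨w₇, hFenceOut, PO⟩ := outerBend_glue hN hNN' hN'N hz hb' ht' p₃ p₄ hO
  set z'new : Site 2 := ![(m' : ℤ), -((m' / 2 : ℕ) : ℤ)] with hz'new
  set znew : Site 2 := ![(N' : ℤ), -((N' / 2 : ℕ) : ℤ)] with hznew
  have hz'new1 : z'new 1 = -((m' / 2 : ℕ) : ℤ) := site_mk_apply_one _ _
  have hznew1 : znew 1 = -((N' / 2 : ℕ) : ℤ) := site_mk_apply_one _ _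
  have hzL := hz; rw [mem_sepLanding] at hzL
  have hz'L := hz'; rw [mem_sepLanding] at hz'L
  have hmz : 2 * (m' : ℤ) + 1 ≤ m := by exact_mod_cast hmm'
  have hmNz : 2 * (m : ℤ) ≤ N := by exact_mod_cast hmN
  have hNN : 4 * (N : ℤ) ≤ N' := by exact_mod_cast hNN'
  -- the old join path, reflected
  have P₅ := pathIn_of_frameConfig_two p₅
  -- everything inside `ρ (new arm region)`
  set Rω : Set (Site 2) := triAnnulusSet m' N' ∪ triOpenBall (triRotIsoPow 1 znew) (N' / 8) ∪ triOpenBall (triRotIsoPow 1 z'new) (m' / 8) with hRω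
  have iI : shellBall m' m (triRotIsoPow 1 z'new) (m' / 8) ⊆ Rω := by
    rintro v (hv | hv)
    · exact Or.inl (Or.inl (mem_triAnnulusSet.2 ⟨hv.1, by have := hv.2; omega⟩))
    · exact Or.inr hv
  have iO : shellBall N N' (triRotIsoPow 1 znew) (N' / 8) ⊆ Rω := by
    rintro v (hv | hv)
    · exact Or.inl (Or.inl (mem_triAnnulusSet.2 ⟨by have := hv.1; omega, hv.2⟩))
    · exact Or.inl (Or.inr hv)
  have oldJ : frameIso 2 '' sepJoinRegion m N z z' ⊆ Rω := by
    rintro _ ⟨w, hw, rfl⟩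
    have hn : triNorm (frameIso 2 w) = triNorm w := triNorm_frameIso 2 (by norm_num) w
    refine Or.inl (Or.inl ?_)
    rw [mem_triAnnulusSet, show ((frameIso 2 : triGraph ≃g triGraph) w) = frameIso 2 w from rfl, hn]
    rcases hw with (hw | hw) | hw
    · rw [mem_triAnnulusSet] at hw; constructor <;> omega
    · rw [mem_triOpenBall, triNorm_lt_iff_lin] at hw
      simp only [Pi.sub_apply] at hw
      have h1 : (N : ℤ) - (N / 8 : ℕ) ≤ triNorm w := le_triNorm_iff_lin.2 (Or.inl (by omega))
      have h2 : triNorm w ≤ (N : ℤ) + (N / 8 : ℕ) := triNorm_le_iff_lin.2 (by omega)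
      constructor <;> omega
    · rw [mem_triOpenBall, triNorm_lt_iff_lin] at hw
      simp only [Pi.sub_apply] at hw
      have h1 : (m : ℤ) - (m / 8 : ℕ) ≤ triNorm w := le_triNorm_iff_lin.2 (Or.inl (by omega))
      have h2 : triNorm w ≤ (m : ℤ) + (m / 8 : ℕ) := triNorm_le_iff_lin.2 (by omega)
      constructor <;> omega
  have PI' : PathIn triGraph (Rω ∩ κ) (frameIso 2 u) (triRotIsoPow 1 w₆) := PI.mono fun v hv => ⟨iI hv.1, hv.2⟩
  have PO' : PathIn triGraph (Rω ∩ κ) (frameIso 2 u') (triRotIsoPow 1 w₇) := PO.mono fun v hv => ⟨iO hv.1, hv.2⟩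
  have P₅' : PathIn triGraph (Rω ∩ κ) (frameIso 2 u) (frameIso 2 u') := P₅.mono fun v hv => ⟨oldJ hv.1, hv.2⟩
  have PathAll : PathIn triGraph (Rω ∩ κ) (triRotIsoPow 1 w₆) (triRotIsoPow 1 w₇) := (PI'.symm.trans P₅').trans PO'
  -- back to the frame `1`
  have Pfin := pathIn_rotConfig_one_of PathAll
  rw [rot5_rot1, rot5_rot1] at Pfin
  obtain ⟨zn0, zn1⟩ := rot1_apply znew
  obtain ⟨zn'0, zn'1⟩ := rot1_apply z'new
  have ez0 : znew 0 = N' := site_mk_apply_zero _ _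
  have ez1 : znew 1 = -((N' / 2 : ℕ) : ℤ) := site_mk_apply_one _ _
  have ez'0 : z'new 0 = m' := site_mk_apply_zero _ _
  have ez'1 : z'new 1 = -((m' / 2 : ℕ) : ℤ) := site_mk_apply_one _ _
  rw [ez0, ez1] at zn1; rw [ez1] at zn0
  rw [ez'0, ez'1] at zn'1; rw [ez'1] at zn'0
  have hsub : triRotIsoPow 5 '' Rω ⊆ sepJoinRegion m' N' znew z'new := by
    rintro _ ⟨v, hv, rfl⟩
    obtain ⟨q0, q1⟩ := rot5_apply v
    have hn : triNorm (triRotIsoPow 5 v) = triNorm v := triNorm_rot 5 v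
    rcases hv with (hv | hv) | hv
    · refine Or.inl (Or.inl ?_)
      rw [mem_triAnnulusSet] at hv ⊢
      rw [show ((triRotIsoPow 5 : triGraph ≃g triGraph) v) = triRotIsoPow 5 v from rfl, hn]; exact hv
    · refine Or.inl (Or.inr ?_)
      rw [mem_triOpenBall, triNorm_lt_iff_lin] at hv ⊢
      simp only [Pi.sub_apply, zn0, zn1] at hv
      simp only [Pi.sub_apply, ez0, ez1, q0, q1]
      omega
    · refine Or.inr ?_
      rw [mem_triOpenBall, triNorm_lt_iff_lin] at hv ⊢
      simp only [Pi.sub_apply, zn'0, zn'1] at hv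
      simp only [Pi.sub_apply, ez'0, ez'1, q0, q1]
      omega
  refine ⟨znew, z'new, w₆, w₇, mk_mem_sepLanding N', mk_mem_sepLanding m', ?_, ?_, Pfin.mono ?_⟩
  · rw [hz'new1]; exact hFenceIn
  · rw [hznew1]; exact hFenceOut
  · rintro v ⟨hv1, hv2⟩
    exact ⟨hsub hv1, hv2⟩

/-! ### Locality and probability of the bends -/

/-- The seven single boxes of the inner bend (fence read in the frame `1`, junction box, connector,
approach, traverse, descent, highway), indexed by `0, …, 6`. [folklore] -/
def inBentSingle (m m' : ℕ) : ℕ → Set (SiteConfig (Site 2))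
  | 0 => {χ | rotConfig 1 χ ∈ triVCross ((m' : ℤ) - (m' / 8 : ℕ) + 2 + (m' / 64 : ℕ)) (-((m' / 2 : ℕ) : ℤ) - (m' / 64 : ℕ)) (m' / 8 - 3 - m' / 64) (2 * (m' / 64))}
  | 1 => triVCross ((m' / 2 : ℕ) : ℤ) (((m' / 2 : ℕ) : ℤ) - (m' / 8 : ℕ) + 2) (m' / 64) (2 * (m' / 8) - 2)
  | 2 => triHCross ((m' / 2 : ℕ) : ℤ) ((m' / 2 : ℕ) : ℤ) (2 * (m' / 64)) (m' / 8)
  | 3 => triVCross ((m' / 2 : ℕ) : ℤ) ((m' / 2 : ℕ) : ℤ) (2 * (m' / 64)) (m - m' + m' / 64 - m' / 2)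
  | 4 => triHCross 1 ((m : ℤ) - m') (m' / 2 + 2 * (m' / 64) - 1) (m' / 64)
  | 5 => triVCross 1 ((m : ℤ) - m') (m / 16) (m' - m / 8 - 2)
  | 6 => triHCross (-(sepGlueHeight m : ℤ)) ((m : ℤ) - (m / 8 : ℕ) - (m / 16 : ℕ) - 2) (sepGlueHeight m + 1 + m / 16) (m / 16)
  | _ => Set.univ

/-- The sites of the seven single boxes of the inner bend. [folklore] -/
def inBentSingleF (m m' : ℕ) : ℕ → Finset (Site 2)
  | 0 => (triStripFinset ((m' : ℤ) - (m' / 8 : ℕ) + 2 + (m' / 64 : ℕ)) (-((m' / 2 : ℕ) : ℤ) - (m' / 64 : ℕ)) (m' / 8 - 3 - m' / 64) (2 * (m' / 64))).image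
      (triRotIsoPow 1)
  | 1 => triStripFinset ((m' / 2 : ℕ) : ℤ) (((m' / 2 : ℕ) : ℤ) - (m' / 8 : ℕ) + 2) (m' / 64) (2 * (m' / 8) - 2)
  | 2 => triStripFinset ((m' / 2 : ℕ) : ℤ) ((m' / 2 : ℕ) : ℤ) (2 * (m' / 64)) (m' / 8)
  | 3 => triStripFinset ((m' / 2 : ℕ) : ℤ) ((m' / 2 : ℕ) : ℤ) (2 * (m' / 64)) (m - m' + m' / 64 - m' / 2)
  | 4 => triStripFinset 1 ((m : ℤ) - m') (m' / 2 + 2 * (m' / 64) - 1) (m' / 64)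
  | 5 => triStripFinset 1 ((m : ℤ) - m') (m / 16) (m' - m / 8 - 2)
  | 6 => triStripFinset (-(sepGlueHeight m : ℤ)) ((m : ℤ) - (m / 8 : ℕ) - (m / 16 : ℕ) - 2) (sepGlueHeight m + 1 + m / 16) (m / 16)
  | _ => ∅

/-- The sites of the `i`-th comb strip of the inner bend. [folklore] -/
def inCombBF (m i : ℕ) : Finset (Site 2) :=
  triStripFinset (-(sepGlueHeight m : ℤ) + i * ((m / 64 / 2 : ℕ) : ℤ)) ((m : ℤ) - (m / 8 : ℕ) - (m / 16 : ℕ) - 2) (m / 64 / 2) (m / 8 + m / 16 + 1)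

/-- The inner bend is the intersection of its pieces. [folklore] -/
theorem inBent_eq (m m' : ℕ) :
    inBent m m' = (⋂ i ∈ Finset.range 7, inBentSingle m m' i) ∩ ⋂ i ∈ Finset.range 90, inCombB m i := by
  ext ω
  constructor
  · rintro ⟨⟨⟨⟨⟨⟨⟨h0, h1⟩, h2⟩, h3⟩, h4⟩, h5⟩, h6⟩, hG⟩
    refine ⟨Set.mem_iInter₂.2 fun i hi => ?_, hG⟩
    have hi' := Finset.mem_range.1 hi
    interval_cases i
    exacts [h0, h1, h2, h3, h4, h5, h6]
  · rintro ⟨h, hG⟩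
    have h' := fun i (hi : i < 7) => (Set.mem_iInter₂.1 h) i (Finset.mem_range.2 hi)
    exact ⟨⟨⟨⟨⟨⟨⟨h' 0 (by norm_num), h' 1 (by norm_num)⟩, h' 2 (by norm_num)⟩, h' 3 (by norm_num)⟩,
      h' 4 (by norm_num)⟩, h' 5 (by norm_num)⟩, h' 6 (by norm_num)⟩, hG⟩

/-- Locality of the single boxes of the inner bend. [folklore] -/
theorem determinedBy_inBentSingle (m m' : ℕ) {i : ℕ} (hi : i < 7) : DeterminedBy (inBentSingle m m' i) ↑(inBentSingleF m m' i) := by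
  interval_cases i
  · rw [inBentSingle, inBentSingleF, Finset.coe_image]
    exact determinedBy_preimage_rotConfig 1 (determinedBy_triVCross _ _ _ _)
  · rw [inBentSingle, inBentSingleF]; exact determinedBy_triVCross _ _ _ _
  · rw [inBentSingle, inBentSingleF]; exact determinedBy_triHCross _ _ _ _
  · rw [inBentSingle, inBentSingleF]; exact determinedBy_triVCross _ _ _ _
  · rw [inBentSingle, inBentSingleF]; exact determinedBy_triHCross _ _ _ _
  · rw [inBentSingle, inBentSingleF]; exact determinedBy_triVCross _ _ _ _
  · rw [inBentSingle, inBentSingleF]; exact determinedBy_triHCross _ _ _ _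

/-- The single boxes of the inner bend are increasing events. [folklore] -/
theorem isUpperSet_inBentSingle (m m' : ℕ) {i : ℕ} (hi : i < 7) : IsUpperSet (inBentSingle m m' i) := by
  interval_cases i
  · rw [inBentSingle]; exact isUpperSet_rot1_triVCross _ _ _ _
  · rw [inBentSingle]; exact isUpperSet_triVCross _ _ _ _
  · rw [inBentSingle]; exact isUpperSet_triHCross _ _ _ _
  · rw [inBentSingle]; exact isUpperSet_triVCross _ _ _ _
  · rw [inBentSingle]; exact isUpperSet_triHCross _ _ _ _
  · rw [inBentSingle]; exact isUpperSet_triVCross _ _ _ _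
  · rw [inBentSingle]; exact isUpperSet_triHCross _ _ _ _

/-- The sites of the inner bend. [folklore] -/
def inBentFinset (m m' : ℕ) : Finset (Site 2) :=
  (Finset.range 7).biUnion (inBentSingleF m m') ∪ (Finset.range 90).biUnion (inCombBF m)

/-- **Locality of the inner bend.** [folklore] -/
theorem determinedBy_inBent (m m' : ℕ) : DeterminedBy (inBent m m') ↑(inBentFinset m m') := by
  classical
  rw [inBent_eq, inBentFinset, Finset.coe_union]
  refine (DeterminedBy.mono ?_ Set.subset_union_left).inter (DeterminedBy.mono ?_ Set.subset_union_right)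
  · exact DeterminedBy.biInter_finset (Finset.range 7) (E := fun i => inBentSingle m m' i) (F := fun i => inBentSingleF m m' i)
      fun i hi => determinedBy_inBentSingle m m' (Finset.mem_range.1 hi)
  · exact DeterminedBy.biInter_finset (Finset.range 90) (E := fun i => inCombB m i) (F := fun i => inCombBF m i)
      fun i _ => determinedBy_triVCross _ _ _ _

/-- Arithmetic helper. [folklore] -/
private theorem masterI2 {m m' : ℕ} (hm' : 1100 ≤ m') (hmm' : 2 * m' + 1 ≤ m) (hm3 : m ≤ 3 * m') :
    ((m' / 2 : ℕ) : ℤ) + 3 * (m' / 64 : ℕ) < m' ∧ ((m' / 64 : ℕ) : ℤ) + (m' / 8 : ℕ) ≤ (m' / 2 : ℕ) ∧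
    ((m / 16 : ℕ) : ℤ) ≤ (m / 8 : ℕ) ∧ (sepGlueHeight m : ℤ) ≤ (m : ℤ) - (m / 8 : ℕ) - (m / 16 : ℕ) - 2 ∧
    (sepGlueHeight m : ℤ) < m ∧ 2 * ((m' / 2 : ℕ) : ℤ) ≤ m' ∧ 1 ≤ ((m' / 64 : ℕ) : ℤ) := by
  have hH := sepGlueHeight_cast m
  refine ⟨by omega, by omega, by omega, by omega, by omega, by omega, by omega⟩

set_option maxHeartbeats 800000 in
/-- **The inner bend lies inside `Λ_m`, in the sectors of the sides `1` and `2`.** [folklore] -/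
theorem inBentFinset_subset {m m' : ℕ} (hm' : 1100 ≤ m') (hmm' : 2 * m' + 1 ≤ m) (hm3 : m ≤ 3 * m') {v : Site 2}
    (hv : v ∈ inBentFinset m m') : triNorm v < m ∧ ((0 ≤ v 0 ∧ 0 < v 1) ∨ (v 0 < 0 ∧ 0 ≤ v 0 + v 1)) := by
  have hmz : 2 * (m' : ℤ) + 1 ≤ m := by exact_mod_cast hmm'
  have hm3z : (m : ℤ) ≤ 3 * m' := by exact_mod_cast hm3
  have hm'z : (1100 : ℤ) ≤ m' := by exact_mod_cast hm'
  obtain ⟨k1, k2, k3, k4, k5, k6, k7⟩ := masterI2 hm' hmm' hm3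
  have F8 := flz m 8 (by norm_num); have F16 := flz m 16 (by norm_num)
  have G2 := flz m' 2 (by norm_num); have G8 := flz m' 8 (by norm_num); have G64 := flz m' 64 (by norm_num)
  simp only [Nat.cast_ofNat] at F8 F16 G2 G8 G64
  have kG0 : (0 : ℤ) ≤ sepGlueHeight m := by positivity
  simp only [inBentFinset, Finset.mem_union, Finset.mem_biUnion, Finset.mem_range] at hv
  rcases hv with ⟨i, hi, hv⟩ | ⟨i, hi, hv⟩
  · interval_cases i
    · rw [inBentSingleF, Finset.mem_image] at hv
      obtain ⟨u, hu, rfl⟩ := hv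
      rw [← Finset.mem_coe, coe_triStripFinset, mem_triStrip, castI4 hm'] at hu
      obtain ⟨r0, r1⟩ := rot1_apply u
      simp only [Nat.cast_mul, Nat.cast_ofNat] at hu
      refine ⟨triNorm_lt_iff_lin.2 ?_, Or.inl ⟨by rw [r0]; linarith, by rw [r1]; linarith⟩⟩
      rw [r0, r1]; exact ⟨by linarith, by linarith, by linarith, by linarith, by linarith, by linarith⟩
    all_goals rw [inBentSingleF, ← Finset.mem_coe, coe_triStripFinset, mem_triStrip] at hv
    · rw [castI5 (by omega)] at hv
      exact ⟨triNorm_lt_iff_lin.2 ⟨by linarith, by linarith, by linarith, by linarith, by linarith, by linarith⟩,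
        Or.inl ⟨by linarith, by linarith⟩⟩
    · simp only [Nat.cast_mul, Nat.cast_ofNat] at hv
      exact ⟨triNorm_lt_iff_lin.2 ⟨by linarith, by linarith, by linarith, by linarith, by linarith, by linarith⟩,
        Or.inl ⟨by linarith, by linarith⟩⟩
    · rw [castI3 hmm'] at hv; simp only [Nat.cast_mul, Nat.cast_ofNat] at hv
      exact ⟨triNorm_lt_iff_lin.2 ⟨by linarith, by linarith, by linarith, by linarith, by linarith, by linarith⟩,
        Or.inl ⟨by linarith, by linarith⟩⟩
    · rw [castI2 (by omega)] at hv
      exact ⟨triNorm_lt_iff_lin.2 ⟨by linarith, by linarith, by linarith, by linarith, by linarith, by linarith⟩,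
        Or.inl ⟨by linarith, by linarith⟩⟩
    · rw [castI1 (by omega) hm3] at hv
      exact ⟨triNorm_lt_iff_lin.2 ⟨by linarith, by linarith, by linarith, by linarith, by linarith, by linarith⟩,
        Or.inl ⟨by linarith, by linarith⟩⟩
    · simp only [Nat.cast_add, Nat.cast_one] at hv
      refine ⟨triNorm_lt_iff_lin.2 ⟨by linarith, by linarith, by linarith, by linarith, by linarith, by linarith⟩, ?_⟩
      rcases lt_or_ge (v 0) 0 with h | h
      · exact Or.inr ⟨h, by linarith⟩
      · exact Or.inl ⟨h, by linarith⟩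
  · rw [inCombBF, ← Finset.mem_coe, coe_triStripFinset, mem_triStrip] at hv
    simp only [Nat.cast_add, Nat.cast_one] at hv
    clear k1 k2 k3 k6 k7 G2 G8 G64
    obtain ⟨kG, -, kS, -⟩ := masterI (i := i) hm' hmm' hm3 hi
    have hih : (0 : ℤ) ≤ (i : ℤ) * ((m / 64 / 2 : ℕ) : ℤ) := by positivity
    have nh : (0 : ℤ) ≤ ((m / 64 / 2 : ℕ) : ℤ) := by positivity
    refine ⟨triNorm_lt_iff_lin.2 ⟨by linarith, by linarith, by linarith, by linarith, by linarith, by linarith⟩, ?_⟩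
    rcases lt_or_ge (v 0) 0 with h | h
    · exact Or.inr ⟨h, by linarith⟩
    · exact Or.inl ⟨h, by linarith⟩

/-- The five single boxes of the outer bend (fence read in the frame `1`, approach, traverse, ascent,
highway), indexed by `0, …, 4`. [folklore] -/
def outBentSingle (N N' : ℕ) : ℕ → Set (SiteConfig (Site 2))
  | 0 => {χ | rotConfig 1 χ ∈ triVCross ((N' : ℤ) + 1) (-((N' / 2 : ℕ) : ℤ) - (N' / 64 : ℕ)) (N' / 16 - 1) (2 * (N' / 64))}
  | 1 => triVCross (((N' / 2 : ℕ) : ℤ) - (N' / 64 : ℕ)) (((N' / 2 : ℕ) : ℤ) - (N' / 16 : ℕ)) (N' / 64) (2 * (N' / 16) + N' / 64 + 1)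
  | 2 => triHCross 1 (((N' / 2 : ℕ) : ℤ) - (N' / 16 : ℕ)) (N' / 2 - 1) (N' / 64)
  | 3 => triVCross 1 ((N : ℤ) + (N / 8 : ℕ) + 1) (2 * (N / 8)) (N' / 2 - N' / 16 + N' / 64 - N - N / 8 - 1)
  | 4 => triHCross (-(sepGlueHeight N : ℤ)) ((N : ℤ) + (N / 8 : ℕ) + 1) (sepGlueHeight N + 1 + 2 * (N / 8)) (N / 8)
  | _ => Set.univ

/-- The sites of the five single boxes of the outer bend. [folklore] -/
def outBentSingleF (N N' : ℕ) : ℕ → Finset (Site 2)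
  | 0 => (triStripFinset ((N' : ℤ) + 1) (-((N' / 2 : ℕ) : ℤ) - (N' / 64 : ℕ)) (N' / 16 - 1) (2 * (N' / 64))).image (triRotIsoPow 1)
  | 1 => triStripFinset (((N' / 2 : ℕ) : ℤ) - (N' / 64 : ℕ)) (((N' / 2 : ℕ) : ℤ) - (N' / 16 : ℕ)) (N' / 64) (2 * (N' / 16) + N' / 64 + 1)
  | 2 => triStripFinset 1 (((N' / 2 : ℕ) : ℤ) - (N' / 16 : ℕ)) (N' / 2 - 1) (N' / 64)
  | 3 => triStripFinset 1 ((N : ℤ) + (N / 8 : ℕ) + 1) (2 * (N / 8)) (N' / 2 - N' / 16 + N' / 64 - N - N / 8 - 1)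
  | 4 => triStripFinset (-(sepGlueHeight N : ℤ)) ((N : ℤ) + (N / 8 : ℕ) + 1) (sepGlueHeight N + 1 + 2 * (N / 8)) (N / 8)
  | _ => ∅

/-- The sites of the `j`-th comb strip of the outer bend. [folklore] -/
def outCombBF (N j : ℕ) : Finset (Site 2) :=
  triStripFinset (-(sepGlueHeight N : ℤ) + j * ((N / 64 / 2 : ℕ) : ℤ)) ((N : ℤ) + 1) (N / 64 / 2) (2 * (N / 8))

/-- The outer bend is the intersection of its pieces. [folklore] -/
theorem outBent_eq (N N' : ℕ) :
    outBent N N' = (⋂ i ∈ Finset.range 5, outBentSingle N N' i) ∩ ⋂ j ∈ Finset.range 90, outCombB N j := by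
  ext ω
  constructor
  · rintro ⟨⟨⟨⟨⟨h0, h1⟩, h2⟩, h3⟩, h4⟩, hG⟩
    refine ⟨Set.mem_iInter₂.2 fun i hi => ?_, hG⟩
    have hi' := Finset.mem_range.1 hi
    interval_cases i
    exacts [h0, h1, h2, h3, h4]
  · rintro ⟨h, hG⟩
    have h' := fun i (hi : i < 5) => (Set.mem_iInter₂.1 h) i (Finset.mem_range.2 hi)
    exact ⟨⟨⟨⟨⟨h' 0 (by norm_num), h' 1 (by norm_num)⟩, h' 2 (by norm_num)⟩, h' 3 (by norm_num)⟩, h' 4 (by norm_num)⟩, hG⟩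

/-- Locality of the single boxes of the outer bend. [folklore] -/
theorem determinedBy_outBentSingle (N N' : ℕ) {i : ℕ} (hi : i < 5) : DeterminedBy (outBentSingle N N' i) ↑(outBentSingleF N N' i) := by
  interval_cases i
  · rw [outBentSingle, outBentSingleF, Finset.coe_image]
    exact determinedBy_preimage_rotConfig 1 (determinedBy_triVCross _ _ _ _)
  · rw [outBentSingle, outBentSingleF]; exact determinedBy_triVCross _ _ _ _
  · rw [outBentSingle, outBentSingleF]; exact determinedBy_triHCross _ _ _ _
  · rw [outBentSingle, outBentSingleF]; exact determinedBy_triVCross _ _ _ _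
  · rw [outBentSingle, outBentSingleF]; exact determinedBy_triHCross _ _ _ _

/-- The single boxes of the outer bend are increasing events. [folklore] -/
theorem isUpperSet_outBentSingle (N N' : ℕ) {i : ℕ} (hi : i < 5) : IsUpperSet (outBentSingle N N' i) := by
  interval_cases i
  · rw [outBentSingle]; exact isUpperSet_rot1_triVCross _ _ _ _
  · rw [outBentSingle]; exact isUpperSet_triVCross _ _ _ _
  · rw [outBentSingle]; exact isUpperSet_triHCross _ _ _ _
  · rw [outBentSingle]; exact isUpperSet_triVCross _ _ _ _
  · rw [outBentSingle]; exact isUpperSet_triHCross _ _ _ _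

/-- The sites of the outer bend. [folklore] -/
def outBentFinset (N N' : ℕ) : Finset (Site 2) :=
  (Finset.range 5).biUnion (outBentSingleF N N') ∪ (Finset.range 90).biUnion (outCombBF N)

/-- **Locality of the outer bend.** [folklore] -/
theorem determinedBy_outBent (N N' : ℕ) : DeterminedBy (outBent N N') ↑(outBentFinset N N') := by
  classical
  rw [outBent_eq, outBentFinset, Finset.coe_union]
  refine (DeterminedBy.mono ?_ Set.subset_union_left).inter (DeterminedBy.mono ?_ Set.subset_union_right)
  · exact DeterminedBy.biInter_finset (Finset.range 5) (E := fun i => outBentSingle N N' i) (F := fun i => outBentSingleF N N' i)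
      fun i hi => determinedBy_outBentSingle N N' (Finset.mem_range.1 hi)
  · exact DeterminedBy.biInter_finset (Finset.range 90) (E := fun j => outCombB N j) (F := fun j => outCombBF N j)
      fun j _ => determinedBy_triVCross _ _ _ _

/-- Arithmetic helper. [folklore] -/
private theorem masterO2 {N N' : ℕ} (hN : 2200 ≤ N) (hNN' : 4 * N ≤ N') (hN'N : N' ≤ 32 * N) :
    2 * ((N' / 2 : ℕ) : ℤ) ≤ N' ∧ (N' : ℤ) ≤ 2 * (N' / 2 : ℕ) + 1 ∧
    ((N' / 16 : ℕ) : ℤ) + (N' / 64 : ℕ) + 1 ≤ (N' / 8 : ℕ) ∧ (N : ℤ) + (N' / 64 : ℕ) + (N' / 16 : ℕ) < 2 * (N' / 2 : ℕ) ∧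
    (N : ℤ) ≤ ((N' / 2 : ℕ) : ℤ) - (N' / 16 : ℕ) ∧ 1 + 2 * ((N / 8 : ℕ) : ℤ) + (N' / 64 : ℕ) ≤ ((N' / 2 : ℕ) : ℤ) ∧
    (sepGlueHeight N : ℤ) < (N : ℤ) + 1 ∧ (N : ℤ) + 1 + 2 * (N / 8 : ℕ) ≤ (N' : ℤ) ∧ ((N' / 16 : ℕ) : ℤ) ≤ (N' / 8 : ℕ) := by
  have hH := sepGlueHeight_cast N
  refine ⟨by omega, by omega, by omega, by omega, by omega, by omega, by omega, by omega, by omega⟩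

set_option maxHeartbeats 800000 in
/-- **The outer bend lies outside `Λ_N` and inside `Λ_{N' + N'/8}`, in the sectors of the sides `1` and
`2`.** [folklore] -/
theorem outBentFinset_subset {N N' : ℕ} (hN : 2200 ≤ N) (hNN' : 4 * N ≤ N') (hN'N : N' ≤ 32 * N) {v : Site 2}
    (hv : v ∈ outBentFinset N N') :
    (N : ℤ) < triNorm v ∧ triNorm v ≤ (N' : ℤ) + (N' / 8 : ℕ) ∧ ((0 ≤ v 0 ∧ 0 < v 1) ∨ (v 0 < 0 ∧ 0 ≤ v 0 + v 1)) := by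
  have hNN : 4 * (N : ℤ) ≤ N' := by exact_mod_cast hNN'
  have hNz : (2200 : ℤ) ≤ N := by exact_mod_cast hN
  obtain ⟨k1, k2, k3, k4, k5, k6, k7, k8, k9⟩ := masterO2 hN hNN' hN'N
  have F8 := flz N 8 (by norm_num)
  have G2 := flz N' 2 (by norm_num); have G8 := flz N' 8 (by norm_num); have G16 := flz N' 16 (by norm_num)
  have G64 := flz N' 64 (by norm_num)
  simp only [Nat.cast_ofNat] at F8 G2 G8 G16 G64
  have kG0 : (0 : ℤ) ≤ sepGlueHeight N := by positivity
  simp only [outBentFinset, Finset.mem_union, Finset.mem_biUnion, Finset.mem_range] at hv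
  rcases hv with ⟨i, hi, hv⟩ | ⟨j, hj, hv⟩
  · interval_cases i
    · rw [outBentSingleF, Finset.mem_image] at hv
      obtain ⟨u, hu, rfl⟩ := hv
      rw [← Finset.mem_coe, coe_triStripFinset, mem_triStrip, castO7 (by omega)] at hu
      obtain ⟨r0, r1⟩ := rot1_apply u
      simp only [Nat.cast_mul, Nat.cast_ofNat] at hu
      refine ⟨lt_triNorm_iff_lin.2 (Or.inr (Or.inr (Or.inr (Or.inr (Or.inl (by rw [r0, r1]; linarith)))))),
        triNorm_le_iff_lin.2 ?_, Or.inl ⟨by rw [r0]; linarith, by rw [r1]; linarith⟩⟩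
      rw [r0, r1]; exact ⟨by linarith, by linarith, by linarith, by linarith, by linarith, by linarith⟩
    all_goals rw [outBentSingleF, ← Finset.mem_coe, coe_triStripFinset, mem_triStrip] at hv
    · simp only [Nat.cast_add, Nat.cast_mul, Nat.cast_ofNat, Nat.cast_one] at hv
      exact ⟨lt_triNorm_iff_lin.2 (Or.inr (Or.inr (Or.inr (Or.inr (Or.inl (by linarith)))))),
        triNorm_le_iff_lin.2 ⟨by linarith, by linarith, by linarith, by linarith, by linarith, by linarith⟩,
        Or.inl ⟨by linarith, by linarith⟩⟩
    · rw [castO5 (by omega)] at hv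
      exact ⟨lt_triNorm_iff_lin.2 (Or.inr (Or.inr (Or.inr (Or.inr (Or.inl (by linarith)))))),
        triNorm_le_iff_lin.2 ⟨by linarith, by linarith, by linarith, by linarith, by linarith, by linarith⟩,
        Or.inl ⟨by linarith, by linarith⟩⟩
    · rw [castO6 hN hNN'] at hv; simp only [Nat.cast_mul, Nat.cast_ofNat] at hv
      exact ⟨lt_triNorm_iff_lin.2 (Or.inr (Or.inr (Or.inr (Or.inr (Or.inl (by linarith)))))),
        triNorm_le_iff_lin.2 ⟨by linarith, by linarith, by linarith, by linarith, by linarith, by linarith⟩,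
        Or.inl ⟨by linarith, by linarith⟩⟩
    · simp only [Nat.cast_add, Nat.cast_mul, Nat.cast_ofNat, Nat.cast_one] at hv
      refine ⟨?_, triNorm_le_iff_lin.2 ⟨by linarith, by linarith, by linarith, by linarith, by linarith, by linarith⟩, ?_⟩
      · exact lt_triNorm_iff_lin.2 (Or.inr (Or.inr (Or.inl (by linarith))))
      · rcases lt_or_ge (v 0) 0 with h | h
        · exact Or.inr ⟨h, by linarith⟩
        · exact Or.inl ⟨h, by linarith⟩
  · rw [outCombBF, ← Finset.mem_coe, coe_triStripFinset, mem_triStrip] at hv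
    simp only [Nat.cast_mul, Nat.cast_ofNat] at hv
    clear k1 k2 k3 k4 k5 k6 k9 G2 G16 G64
    obtain ⟨kG, kS, -⟩ := masterO (j := j) hN hNN' hN'N hj
    have hjh : (0 : ℤ) ≤ (j : ℤ) * ((N / 64 / 2 : ℕ) : ℤ) := by positivity
    have nh : (0 : ℤ) ≤ ((N / 64 / 2 : ℕ) : ℤ) := by positivity
    refine ⟨lt_triNorm_iff_lin.2 (Or.inr (Or.inr (Or.inl (by linarith)))),
      triNorm_le_iff_lin.2 ⟨by linarith, by linarith, by linarith, by linarith, by linarith, by linarith⟩, ?_⟩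
    rcases lt_or_ge (v 0) 0 with h | h
    · exact Or.inr ⟨h, by linarith⟩
    · exact Or.inl ⟨h, by linarith⟩

end Literature.Probability.Percolation
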